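import Mathlib.Analysis.InnerProductSpace.Projection.Reflection
import Literature.MathematicalPhysics.StatisticalMechanics.FccTexturedSet
import Literature.Geometry.DiscreteGeometry.LayerShellPatterns
import Literature.Geometry.DiscreteGeometry.LayerPropagation
import Literature.Barriers.AtomisticToContinuum.HcpNotBravais
import HarnessLib

/-!
# Barlow-textured sets: phase-aware (fcc / hcp / general Barlow stacking) blow-down limits of
# sticky-sphere clusters

Topic `Literature/MathematicalPhysics/StatisticalMechanics` (namespace = path). Definition request
`defn-BarlowTexturedLimit` of the venture `Summits/Ventures/Crystal3D` (route `StickyWulffConstant`,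
item `TextureLiminf`; planner cell `crystal3d-full`), extending `FccTexturedSet.lean`
(`TexturedSet`, `FccTexturedSet`, `IsOrientationObservable`, `TexturedSet.IsBlowDownLimit`): the
continuum state space and the convergence notion for the `N^{1/3}` blow-down of sticky-sphere
clusters whose grains are general BARLOW stackings (close-packed triangular layers in positions
`A/B/C`, coded by a Hägg sequence of letters `±1`; fcc `= …+++…`, its twin `= …−−−…`,
hcp `= …+−+−…`) rather than fcc crystals. Everything here is a definition with a body or a proved
theorem; no named facts, no compactness or `Γ`-liminf assertion.

## Contents

§1 The two normalisations: touching unit-diameter balls (`barlowStacking 1 √(2/3) s`,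
   `fccHost`, this file and `FccTexturedSet.lean`) versus Hales's (`barlowStacking 2 𝗁 s`,
   `𝗁 = layerSpacing = 2√(2/3)`, `LayerShells.lean`): `barlowPos_two_layerSpacing`,
   `mem_barlowStacking_one_iff`.
§2 `barlowShell σ τ = ½ · layerShell σ τ` — the twelve touching neighbours, recentred, of a ball
   whose layer above is shifted by the letter `σ` and whose layer below by `τ` (`σ, τ = ±1`):
   `τ = −σ` cuboctahedron (FCC-type site), `τ = σ` anticuboctahedron (HCP-type site);
   `mem_barlowShell_iff`, `ncard_barlowShell = 12`, `norm_eq_one_of_mem_barlowShell`.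
§3 The stacking axis `axisUnit = e₃`, the half-turn `rotPi = R_π` about it (Mathlib's reflection in
   the line `ℝe₃`; `rotPi_apply`, it negates horizontal vectors and fixes `𝗁e₃`); antipodal pairs
   in layer shells (`apply_two_eq_zero_of_neg_mem_layerShell`: in an anticuboctahedron exactly the
   six hexagon vectors have their antipode in the shell, `neg_mem_layerShell_hcp_iff`); linear
   isometries between layer shells: **no isometry maps an anticuboctahedron onto a cuboctahedron**
   (`image_layerShell_hcp_ne_fcc`, `image_layerShell_fcc_ne_hcp`), and an isometry between two
   anticuboctahedra preserves the hexagon, maps the axis vector to `±` itself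
   (`map_layerNormal_of_image_layerShell_hcp`) and transports the hole triples and all four layer
   shells (`image_layerShell_eq_of_image_layerShell_hcp`), in particular the pair of cuboctahedra
   seen from the shell (`image_layerShell_fcc_of_image_layerShell_hcp`).
§4 The shells of the close-packed stackings at unit spacing
   (`touching_barlowStacking_eq_image_barlowShell`; `barlowShell 1 (−1)` = unit neighbours of `0`
   in `fccHost`, `barlowShell 1 1` = those in `hcpStacking 1 √(2/3)`), and **`Λ₀ = fccHost` is the
   lattice generated by its shell** (`fccHost_eq_closure_barlowShell`), so the orientation class
   `F(Λ₀)` of a frame is determined by the image of the shell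
   (`image_fccHost_eq_of_image_barlowShell_eq`).
§5 `R_π` exchanges the letters (`image_rotPi_barlowShell`); the letter frames `letterFrame σ = M_σ`
   (`M_1 = 1`, `M_{−1} = R_π`), `M_σ(barlowShell 1 (−1)) = barlowShell σ (−σ)`.
§6 Per-ball predicates for a configuration `X ⊆ ℝ³`: `BarlowShellAt X p L σ τ` (the balls of `X`
   touching `p` are `p + L(barlowShell σ τ)`), `IsBarlowAt`, `IsFccTypeAt` (c-site), `IsHcpTypeAt`
   (h-site); twelve neighbours, `isBarlowAt_iff`, **exclusivity** `not_isFccTypeAt_of_isHcpTypeAt`;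
   every site of every close-packed stacking is Barlow (`barlowShellAt_barlowStacking`), fcc sites
   are c-sites (`isFccTypeAt_fccHost`), hcp sites are h-sites (`isHcpTypeAt_hcpStacking`).
§7 Gap frames `upFrame L σ = L ∘ M_σ`, `downFrame L τ = L ∘ M_{−τ}` of a shell datum and the
   **well-definedness of the pair of gap classes** (`gapClasses_eq_or_swap`); the Barlow weight
   `barlowWeight g X p = ½ (g(L∘M_σ) + g(L∘M_{−τ}))` of an fcc orientation observable `g`
   (`IsOrientationObservable fccHost g`), `0` off Barlow points, independent of the datum
   (`barlowWeight_eq`), `= g(L∘M_σ)` at c-sites.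
§8 Bridge to `FccTexturedSet.lean`: an fcc-crystallized point (`LocallyCrystallineAt fccHost 1`) is
   a c-site with the same frame (`BarlowShellAt.of_locallyCrystallineAt`); the uniqueness
   hypothesis of `orientationWeight_eq` HOLDS for `Λ₀` at radius `1`
   (`image_fccHost_eq_of_locallyCrystallineAt`); the two weights agree
   (`orientationWeight_eq_barlowWeight`).
§9 `barlowTexturedAverage`, the structure `BarlowTexturedSet` (an `FccTexturedSet` plus measurable
   sign densities `λ_j : ℝ³ → [0,1]`), `gapLimit`, the convergence `BarlowTexturedSet.IsBlowDownLimit`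
   and `IsBlowDownLimitOfClusters`; constructors `ofFcc` (`λ ≡ 1`), `singleGrain`, `fccCrystal`,
   `halfSignCrystal` (`λ ≡ ½`); `gapLimit_ofFcc`, `gapLimit_one`, **`IsBlowDownLimit.barlow_mass`**
   (Barlow-crystallized balls carry all the mass), and the sanity theorem
   **`FccTexturedSet.IsBlowDownLimit.ofFcc`**: an fcc blow-down limit is a Barlow blow-down limit
   with `λ ≡ 1` and the same frames.
§10 Bridge to Hales's patterns (`IsArrangedIn`, `fccKissingPattern`, `hcpKissingPattern` of
   `KissingPatterns.lean` / `FejesTothKissingTwelve.lean`; the venture's `IsClosePackedShell`):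
   `doubledShellAt X p = {2(x − p)}`; `isFccTypeAt_iff_isArrangedIn`, `isHcpTypeAt_iff_isArrangedIn`,
   `isBarlowAt_iff_isArrangedIn`, `not_isArrangedIn_fcc_and_hcp`.

## Sources, as printed

* T. C. Hales, *Dense Sphere Packings: a blueprint for formal proofs* (LMS LN 400, CUP 2012), §1.3,
  pp. 12–13, Fig. 1.11–1.12: the FCC pattern (cuboctahedron) and the HCP pattern ("the top layer
  of the HCP pattern is rotated 60 degrees with respect to the FCC pattern … a uniquely determined
  plane of reflectional symmetry, containing six of the twelve points"); "In each of these packings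
  the tangent arrangement around each ball is the FCC or HCP arrangement" — the tree's
  `layerShell`, `kissingShell_barlowStacking_eq_layerShell` (`LayerShellPatterns.lean`).
* J. H. Conway, N. J. A. Sloane, *Sphere Packings, Lattices and Groups*, 3rd ed. (1999), Ch. 1
  §1.3 and Preface (Barlow packings by layers `a/b/c`), Ch. 4 §6.3 (`D₃` = fcc, minimal vectors).
* L. Kreutz, T. Ziereis, arXiv:2604.19239 (2026), §2: the polycrystal state space `PC(ℝ^d; 𝒵)`
  ((2.11)–(2.13)), the piecewise-constant orientation field (2.10), the convergence Def. 2.3 and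
  the shape of the compactness Thm. 2.4 — as transcribed in `FccTexturedSet.lean`; the present file
  adjoins a PHASE VARIABLE (the sign density) to the orientation.
* M. Cicalese, L. Kreutz, G. P. Leonardi, CMP 402 (2023), Thm. 2.3 / Prop. 2.5: the `N^{-1/3}`
  scaling, limits `√2 χ_E`, fcc and hcp competitors; Y. Au Yeung, G. Friesecke, B. Schmidt (2012),
  Thm. 1.1: subsequences and translations.
* The requester's memo (planner cell `crystal3d-full`, ROUTE.md §56(b), §57(d)): the broken-bond
  surface energy density of a Barlow stacking with facet normal `ν` is
  `λ φ_fcc(ν) + (1 − λ) φ_twin(ν)`, AFFINE in the density `λ` of `+1` Hägg letters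
  (`φ_hcp = ½(φ_fcc + φ_twin)`); the limit phases are "(Barlow frame, sign density `λ ∈ [0,1]`)".
  Not a published statement; it motivates the choice of the recorded statistic, nothing here
  depends on it.

## Design (what is and is not asserted; deviations from the request, with reasons)

* LETTERS, NOT PARITY. The request's `BarlowShellAt X p L (s : Bool)` (cuboctahedron /
  anticuboctahedron up to the frame) is `BarlowShellAt X p L σ (−σ)` / `BarlowShellAt X p L σ σ`;
  the two letters are kept because the frame `L` of a Barlow grain fixes the triangular layer AND
  the hole triple `T` (`R_π T = −T`), so that relative to `L` every interlayer gap has a letter, and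
  the letters are what the sign density counts. In a perfect stacking the shells at the layers of
  letter `−1` are the `R_π`-rotated shells of the layers of letter `+1` (an "exact frame `L_j`"
  count, as in the request's (ii), would see only every other layer of an hcp grain).
* GAP CLASSES, NOT c-SITE COUNTS. The request's (iii) ("the empirical measure of fcc-type balls
  with frame `L_j` converges to `λ_j χ_{G_j}`") is replaced by the field `gaps`: each
  Barlow-crystallized ball gives half of its mass to the cubic class `[L∘M_σ] ∈ O(3)/O_h` of the gap
  above it and half to the class `[L∘M_{−τ}]` of the gap below, and on grain `j` these classes are
  asymptotically distributed as `λ_j δ_{[L_j]} + (1 − λ_j) δ_{[L_j R_π]}`. Reasons: (a) the shell of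
  a c-site determines its frame only up to the cubic group `O_h` (four equivalent `⟨111⟩` axes), so
  "frame `= L_j` up to the stabiliser of the axis" is not a property of the ball — only the cubic
  CLASS is, and that is what `IsOrientationObservable fccHost` observables see (the request's
  "quantify over frame observables" — the common stabiliser `D_3d ∩ D_3h` does not act transitively
  enough for a per-ball axis reading at c-sites); (b) the density of c-sites (letters `(σ, −σ)`,
  Jagodzinski's `c` layers) is a letter-PAIR statistic which does not determine the sign density:
  hcp (`…+−+−…`, `λ = ½`) and the twin crystal (`…−−−…`, `λ = 0`) both have no c-site of letter
  `+1`, yet `φ_hcp ≠ φ_twin`; the gap statistic has barycentre exactly `λ` (in a perfect grain the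
  ball of layer `k` contributes `½ δ_{[L M_{s_k}]} + ½ δ_{[L M_{s_{k−1}}]}`, so every gap is counted
  once). The pair of classes at a ball is well defined (`gapClasses_eq_or_swap`, proved: c–c by the
  lattice generated by the shell, h–h by the antipode argument of §3, c–h impossible).
* DENSITY `√2`. The request's "(i) … converge weakly to `(1/√2)·1_E`" is inconsistent with mass `1`
  and `|E| = 1/√2`; as in `TexturedSet.IsBlowDownLimit` (which the request cites) the limit density
  is the fcc number density `√2` (`√2 · |E| = 1`).
* EQUIVALENT DATA. `(L_j, λ_j)` and `(L_j ∘ R_π, 1 − λ_j)` have the same `gapLimit`, and so do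
  `(L_j ∘ S, λ_j)` for `S` in the stabiliser `D_3d` of the axis in `O_h` (`[L S] = [L]`,
  `[L S R_π] = [L R_π]` as `D_3d` is normal in `D_6h = ⟨D_3d, R_π⟩`) — not formalised; for
  `λ_j ∈ {0,1}` a.e. the axis of `L_j` is immaterial. No uniqueness of the representing data is
  claimed or needed.
* YOUNG-MEASURE FORM. As in `FccTexturedSet.lean` the convergence is tested against `f ⊗ g` with
  continuous `g`, so frames at finite `k` need not equal `L_j` (rotating or slightly polycrystalline
  approximants converge); per-ball frames are read GEOMETRICALLY from exact contacts (distance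
  exactly `1`), the only reading available for sticky hard spheres.
* NOT HERE: any compactness or `Γ`-liminf statement (route items); the `c/h` (letter-pair) density
  and axis statistics at h-sites (would need a further field; an isometry between anticuboctahedra
  does fix the axis, §3, so h-site axis observables are well defined — left for a sequel if a route
  needs them); the converse bridge `BarlowShellAt X p R 1 (−1) → LocallyCrystallineAt fccHost 1 X p R`
  (true for hard-core `X ∋ p`, not needed here); a `TextureCompact` analogue.
* Imports `Literature/Barriers/AtomisticToContinuum/HcpNotBravais.lean` only for the proved fact
  that `fccStacking a h` is an additive subgroup (`fccStacking_eq_coe_addSubgroup`).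
-/

noncomputable section

open MeasureTheory Filter Set Function
open scoped Topology ENNReal BigOperators InnerProductSpace RealInnerProductSpace

namespace Literature.MathematicalPhysics.StatisticalMechanics

open _root_.MeasureTheory _root_.Topology
open Literature.Geometry.DiscreteGeometry

/-! ## §1 The two normalisations: unit sphere diameter vs. Hales's `(2, 𝗁)` -/

/-- Hales's layer spacing `𝗁 = 2√(2/3)` is twice the ideal layer spacing `√(2/3)` of touching
unit-diameter balls. [cite: HalesDSP2012, §1.3 (pp. 12–13: unit balls, touching centres at distance 2)] -/
theorem layerSpacing_eq_two_mul : layerSpacing = 2 * Real.sqrt (2 / 3) := rfl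

/-- Doubling the touching-ball stacking gives Hales's stacking, point by point:
`barlowPos 2 𝗁 s k i j = 2 • barlowPos 1 √(2/3) s k i j` (the same identity is proved on the
summit side as `Summit.Ventures.Crystal3D.barlowPos_two_eq_two_smul` in
`Summits/Ventures/Crystal3D/Bulk/RadiusTwoBarlowHolds.lean`; restated because Literature does not
import Summits). [cite: HalesDSP2012, §1.3 (pp. 12–13: unit balls, touching centres at distance 2)] -/
theorem barlowPos_two_layerSpacing (s : ℤ → ℤ) (k i j : ℤ) :
    barlowPos 2 layerSpacing s k i j = (2 : ℝ) • barlowPos 1 (Real.sqrt (2 / 3)) s k i j := by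
  ext n
  fin_cases n <;> simp [layerSpacing] <;> ring

/-- `x` lies in the touching-ball stacking iff `2x` lies in Hales's stacking. [cite: HalesDSP2012, §1.3 (pp. 12–13: unit balls, touching centres at distance 2)] -/
theorem mem_barlowStacking_one_iff {s : ℤ → ℤ} {x : EuclideanSpace ℝ (Fin 3)} :
    x ∈ barlowStacking 1 (Real.sqrt (2 / 3)) s ↔ (2 : ℝ) • x ∈ barlowStacking 2 layerSpacing s := by
  constructor
  · rintro ⟨k, i, j, rfl⟩
    exact ⟨k, i, j, by rw [barlowPos_two_layerSpacing]⟩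
  · rintro ⟨k, i, j, hx⟩
    refine ⟨k, i, j, ?_⟩
    have h2 : (2 : ℝ) • x = (2 : ℝ) • barlowPos 1 (Real.sqrt (2 / 3)) s k i j := by
      rw [hx, barlowPos_two_layerSpacing]
    exact smul_right_injective _ (two_ne_zero (α := ℝ)) h2

/-! ## §2 The Barlow shells at unit spacing -/

/-- **The Barlow shell with up-letter `σ` and down-letter `τ`** (`σ, τ = ±1`) at unit sphere
diameter: `½ · layerShell σ τ` — the unit hexagon `½H = {±u, ±v, ±(u − v)}` (`u = (1,0,0)`,
`v = (½, √3/2, 0)`), the three points `σ·½T + √(2/3) e₃` above (`T = {w, w − u₁, w − u₂}` the hole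
triple of `LayerShells.lean`) and the three points `τ·½T − √(2/3) e₃` below: the twelve touching
neighbours, recentred, of a ball of a close-packed stacking whose layer above is shifted by the
letter `σ` and whose layer below by the letter `τ`. `τ = −σ`: cuboctahedron (FCC type, local
stacking `ABC`); `τ = σ`: anticuboctahedron (HCP type, local stacking `ABA`). The shells of
`fccHost = fccStacking 1 √(2/3)` are `barlowShell 1 (−1)`, those of `hcpStacking 1 √(2/3)` are
`barlowShell s s` (`barlowShellAt_barlowStacking`). [cite: HalesDSP2012, §1.3 (Fig. 1.11–1.12)] -/
def barlowShell (σ τ : ℝ) : Set (EuclideanSpace ℝ (Fin 3)) :=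
  (fun x => (2 : ℝ)⁻¹ • x) '' layerShell σ τ

/-- Membership in the unit-spacing shell: `v ∈ barlowShell σ τ ↔ 2v ∈ layerShell σ τ`. [cite: HalesDSP2012, §1.3 (Fig. 1.11)] -/
theorem mem_barlowShell_iff {σ τ : ℝ} {v : EuclideanSpace ℝ (Fin 3)} :
    v ∈ barlowShell σ τ ↔ (2 : ℝ) • v ∈ layerShell σ τ := by
  constructor
  · rintro ⟨x, hx, rfl⟩
    simpa [smul_smul] using hx
  · intro h
    exact ⟨(2 : ℝ) • v, h, by simp [smul_smul]⟩

/-- The image of a unit-spacing shell under a linear map `M` is computed at spacing `2`: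
`M '' barlowShell σ τ = ½ · (M '' layerShell σ τ)`. [folklore] -/
private theorem image_barlowShell_eq {σ τ : ℝ}
    (M : EuclideanSpace ℝ (Fin 3) →ₗ[ℝ] EuclideanSpace ℝ (Fin 3)) :
    M '' barlowShell σ τ = (fun x => (2 : ℝ)⁻¹ • x) '' (M '' layerShell σ τ) := by
  rw [barlowShell, Set.image_image, Set.image_image]
  refine Set.image_congr' fun x => ?_
  rw [map_smul]

/-- Halving is injective on sets: `½·A = ½·B ↔ A = B`. [folklore] -/
private theorem image_half_eq_image_half_iff {A B : Set (EuclideanSpace ℝ (Fin 3))} :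
    (fun x => (2 : ℝ)⁻¹ • x) '' A = (fun x => (2 : ℝ)⁻¹ • x) '' B ↔ A = B :=
  (Set.image_injective.2 (smul_right_injective _ (inv_ne_zero (two_ne_zero (α := ℝ))))).eq_iff

/-- Two linear maps carry two unit-spacing shells to the same set iff they do so at spacing `2`.
[folklore] -/
private theorem image_barlowShell_eq_iff {σ τ σ' τ' : ℝ}
    (M M' : EuclideanSpace ℝ (Fin 3) →ₗ[ℝ] EuclideanSpace ℝ (Fin 3)) :
    M '' barlowShell σ τ = M' '' barlowShell σ' τ' ↔
      M '' layerShell σ τ = M' '' layerShell σ' τ' := by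
  rw [image_barlowShell_eq, image_barlowShell_eq, image_half_eq_image_half_iff]

/-- The unit-spacing shells are finite (twelve points at most). [cite: HalesDSP2012, §1.3 (Fig. 1.11)] -/
theorem finite_barlowShell (σ τ : ℝ) : (barlowShell σ τ).Finite :=
  (finite_layerShell σ τ).image _

/-- A unit-spacing shell of letters `±1` has exactly twelve points. [cite: HalesDSP2012, §1.3] -/
theorem ncard_barlowShell {σ τ : ℝ} (hσ : σ = 1 ∨ σ = -1) (hτ : τ = 1 ∨ τ = -1) :
    (barlowShell σ τ).ncard = 12 := by
  rw [barlowShell, Set.ncard_image_of_injective _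
    (smul_right_injective _ (inv_ne_zero (two_ne_zero (α := ℝ)))), ncard_layerShell hσ hτ]

/-! ## §3 Letters, the half-turn about the stacking axis, antipodes -/

/-- The unit vector `e₃` of the stacking axis. [folklore] -/
def axisUnit : EuclideanSpace ℝ (Fin 3) := EuclideanSpace.single 2 1

/-- `e₃ = (0, 0, 1)`: first coordinate. [folklore] -/
@[simp] private theorem axisUnit_apply_zero : axisUnit 0 = 0 := by simp [axisUnit]

/-- `e₃ = (0, 0, 1)`: second coordinate. [folklore] -/
@[simp] private theorem axisUnit_apply_one : axisUnit 1 = 0 := by simp [axisUnit]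

/-- `e₃ = (0, 0, 1)`: third coordinate. [folklore] -/
@[simp] private theorem axisUnit_apply_two : axisUnit 2 = 1 := by simp [axisUnit]

/-- **The half-turn about the stacking axis** `R_π : (x, y, z) ↦ (−x, −y, z)` — Mathlib's
reflection in the line `ℝ e₃`. It exchanges the two letters: `R_π(±w) = ∓w`, so it carries the
shell of letters `(σ, τ)` to the shell of letters `(−σ, −τ)` (`image_rotPi_layerShell`), and the
fcc packing `Λ₀ = fccHost` (`…ABC…`) to its twin `R_π Λ₀` (`…ACB…`), the rotation by `60°` about a
`⟨111⟩` axis of the cubic description. [folklore] -/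
def rotPi : EuclideanSpace ℝ (Fin 3) ≃ₗᵢ[ℝ] EuclideanSpace ℝ (Fin 3) :=
  (ℝ ∙ axisUnit).reflection

/-- Coordinates of the half-turn: `R_π x = (−x₀, −x₁, x₂)`. [cite: HalesDSP2012, §1.3 (Fig. 1.11)] -/
theorem rotPi_apply (x : EuclideanSpace ℝ (Fin 3)) :
    rotPi x = (2 * x 2) • axisUnit - x := by
  have hn : ‖axisUnit‖ = 1 := by simp [axisUnit]
  have hi : ⟪axisUnit, x⟫ = x 2 := by simp [axisUnit, EuclideanSpace.inner_single_left]
  ext n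
  rw [rotPi, Submodule.reflection_apply, Submodule.starProjection_singleton, hn, hi, two_smul]
  fin_cases n
  · simp
  · simp
  · simp; ring

/-- `(R_π x)₀ = −x₀`. [cite: HalesDSP2012, §1.3 (Fig. 1.11)] -/
@[simp] theorem rotPi_apply_zero (x : EuclideanSpace ℝ (Fin 3)) : rotPi x 0 = -x 0 := by
  simp [rotPi_apply]

/-- `(R_π x)₁ = −x₁`. [cite: HalesDSP2012, §1.3 (Fig. 1.11)] -/
@[simp] theorem rotPi_apply_one (x : EuclideanSpace ℝ (Fin 3)) : rotPi x 1 = -x 1 := by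
  simp [rotPi_apply]

/-- `(R_π x)₂ = x₂`. [cite: HalesDSP2012, §1.3 (Fig. 1.11)] -/
@[simp] theorem rotPi_apply_two (x : EuclideanSpace ℝ (Fin 3)) : rotPi x 2 = x 2 := by
  simp [rotPi_apply]; ring

/-- The half-turn negates horizontal vectors. [cite: HalesDSP2012, §1.3 (Fig. 1.11)] -/
theorem rotPi_of_apply_two_eq_zero {x : EuclideanSpace ℝ (Fin 3)} (hx : x 2 = 0) :
    rotPi x = -x := by
  ext n; fin_cases n <;> simp [hx]

/-- The half-turn fixes the interlayer vector `𝗁 e₃`. [cite: HalesDSP2012, §1.3 (Fig. 1.11)] -/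
@[simp] theorem rotPi_layerNormal (c : ℝ) : rotPi (layerNormal c) = layerNormal c := by
  ext n; fin_cases n <;> simp [layerNormal]

/-- The half-turn is an involution. [cite: HalesDSP2012, §1.3 (Fig. 1.11)] -/
@[simp] theorem rotPi_rotPi (x : EuclideanSpace ℝ (Fin 3)) : rotPi (rotPi x) = x := by
  ext n; fin_cases n <;> simp

/-- The half-turn is its own inverse. [cite: HalesDSP2012, §1.3 (Fig. 1.11)] -/
@[simp] theorem rotPi_symm : rotPi.symm = rotPi := Submodule.reflection_symm

/-! ### Antipodal pairs in a layer shell (spacing `2`)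

The cuboctahedra `layerShell α (−α)` are centrally symmetric (`neg_mem_layerShell_neg`,
`LayerPropagation.lean`); in an anticuboctahedron `layerShell α α` exactly the six hexagon points
have their antipode in the shell. (The same computation is used, for a different purpose, in the
venture file `Summits/Ventures/Crystal3D/Bulk/TwinJunctionBarlow.lean`; it is re-proved here because
Literature does not import Summits.) -/

/-- Second coordinates in the basic hole triple, times `√3`: `1, 1, −2`. [folklore] -/
private theorem holeTriple_one_apply_one_mul {t : EuclideanSpace ℝ (Fin 3)} (ht : t ∈ holeTriple 1) :
    t 1 * Real.sqrt 3 = 1 ∨ t 1 * Real.sqrt 3 = -2 := by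
  have h3 : Real.sqrt 3 ^ 2 = 3 := Real.sq_sqrt (by norm_num)
  rw [mem_holeTriple_one_iff] at ht
  rcases ht with rfl | rfl | rfl
  · left; simp; linear_combination (1 / 3 : ℝ) * h3
  · left; simp; linear_combination (1 / 3 : ℝ) * h3
  · right; simp; linear_combination (1 / 3 - 1 : ℝ) * h3

/-- The hole triples of opposite type are disjoint. [folklore] -/
private theorem not_mem_holeTriple_neg_one_of_mem {t : EuclideanSpace ℝ (Fin 3)}
    (ht : t ∈ holeTriple 1) (ht' : t ∈ holeTriple (-1)) : False := by
  have h1 := holeTriple_one_apply_one_mul ht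
  rw [mem_holeTriple_iff] at ht'
  obtain ⟨t₀, ht₀, rfl⟩ := ht'
  have h2 := holeTriple_one_apply_one_mul ht₀
  simp only [PiLp.smul_apply, smul_eq_mul, neg_mul, one_mul] at h1
  rcases h1 with h1 | h1 <;> rcases h2 with h2 | h2 <;> linarith

/-- Two hole triples of types `±1` sharing a point have the same type (summit-side twin:
`Summit.Ventures.Crystal3D.eq_of_mem_holeTriple`, `Bulk/TwinJunctionBarlow.lean`). [cite: HalesDSP2012, §1.3 (Fig. 1.12: the two positions of an adjacent layer)] -/
theorem holeTriple_type_eq_of_mem {σ τ : ℝ} (hσ : σ = 1 ∨ σ = -1) (hτ : τ = 1 ∨ τ = -1)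
    {t : EuclideanSpace ℝ (Fin 3)} (h₁ : t ∈ holeTriple σ) (h₂ : t ∈ holeTriple τ) : σ = τ := by
  rcases hσ with rfl | rfl <;> rcases hτ with rfl | rfl
  · rfl
  · exact (not_mem_holeTriple_neg_one_of_mem h₁ h₂).elim
  · exact (not_mem_holeTriple_neg_one_of_mem h₂ h₁).elim
  · rfl

/-- **Antipodal shell vectors of a layer shell are horizontal, except in the cuboctahedron**:
if `z` and `−z` both lie in `layerShell α β` (`α, β = ±1`) then `z` is a hexagon vector or the
shell is of FCC type `β = −α` (summit-side twin, same statement and proof: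
`Summit.Ventures.Crystal3D.apply_two_eq_zero_of_neg_mem_layerShell`, `Bulk/TwinJunctionBarlow.lean`;
restated because Literature does not import Summits). [cite: HalesDSP2012, §1.3 (Fig. 1.11: the plane of reflectional symmetry contains six of the twelve points)] -/
theorem apply_two_eq_zero_of_neg_mem_layerShell {α β : ℝ} (hα : α = 1 ∨ α = -1)
    (hβ : β = 1 ∨ β = -1) {z : EuclideanSpace ℝ (Fin 3)} (hz : z ∈ layerShell α β)
    (hnz : -z ∈ layerShell α β) : z 2 = 0 ∨ β = -α := by
  have hnα : -α = 1 ∨ -α = -1 := by rcases hα with rfl | rfl <;> norm_num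
  have hnβ : -β = 1 ∨ -β = -1 := by rcases hβ with rfl | rfl <;> norm_num
  rw [mem_layerShell_iff] at hz hnz
  rcases hz with hz | hz | hz
  · exact Or.inl (apply_two_of_mem_hexagonSet hz)
  · have hz2 : z 2 = layerSpacing := by
      have := apply_two_of_mem_holeTriple hz
      simp at this; linarith
    rcases hnz with hnz | hnz | hnz
    · left; have := apply_two_of_mem_hexagonSet hnz; simpa using this
    · exfalso
      have := apply_two_of_mem_holeTriple hnz
      simp at this; linarith [layerSpacing_pos]
    · right
      have h' : z - layerNormal layerSpacing ∈ holeTriple (-β) := by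
        rw [← neg_mem_holeTriple_iff]
        have : -(z - layerNormal layerSpacing) = -z + layerNormal layerSpacing := by abel
        rw [this]; exact hnz
      have := holeTriple_type_eq_of_mem hα hnβ hz h'
      linarith
  · have hz2 : z 2 = -layerSpacing := by
      have := apply_two_of_mem_holeTriple hz
      simp at this; linarith
    rcases hnz with hnz | hnz | hnz
    · left; have := apply_two_of_mem_hexagonSet hnz; simpa using this
    · right
      have h' : z + layerNormal layerSpacing ∈ holeTriple (-α) := by
        rw [← neg_mem_holeTriple_iff]
        have : -(z + layerNormal layerSpacing) = -z - layerNormal layerSpacing := by abel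
        rw [this]; exact hnz
      have := holeTriple_type_eq_of_mem hβ hnα hz h'
      linarith
    · exfalso
      have := apply_two_of_mem_holeTriple hnz
      simp at this; linarith [layerSpacing_pos]

/-- A horizontal shell vector is a hexagon vector (the caps sit at heights `±𝗁 ≠ 0`). [cite: HalesDSP2012, §1.3 (Fig. 1.11)] -/
theorem mem_hexagonSet_of_apply_two_eq_zero {α β : ℝ} {z : EuclideanSpace ℝ (Fin 3)}
    (hz : z ∈ layerShell α β) (h2 : z 2 = 0) : z ∈ hexagonSet := by
  rcases mem_layerShell_iff.1 hz with h | h | h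
  · exact h
  · exfalso
    have := apply_two_of_mem_holeTriple h
    simp [h2] at this
    exact layerSpacing_pos.ne' (by linarith)
  · exfalso
    have := apply_two_of_mem_holeTriple h
    simp [h2] at this
    exact layerSpacing_pos.ne' (by linarith)

/-- **In an anticuboctahedron `layerShell α α` the antipode of a shell vector is a shell vector
iff the vector is one of the six hexagon vectors.** [cite: HalesDSP2012, §1.3 (Fig. 1.11: "a
uniquely determined plane of reflectional symmetry, containing six of the twelve points")] -/
theorem neg_mem_layerShell_hcp_iff {α : ℝ} (hα : α = 1 ∨ α = -1) {z : EuclideanSpace ℝ (Fin 3)}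
    (hz : z ∈ layerShell α α) : -z ∈ layerShell α α ↔ z ∈ hexagonSet := by
  constructor
  · intro hnz
    rcases apply_two_eq_zero_of_neg_mem_layerShell hα hα hz hnz with h | h
    · exact mem_hexagonSet_of_apply_two_eq_zero hz h
    · exfalso; rcases hα with rfl | rfl <;> norm_num at h
  · intro h
    exact hexagonSet_subset_layerShell _ _ (neg_mem_hexagonSet h)

/-- The cap vector `α w + 𝗁 e₃` of the anticuboctahedron `layerShell α α`. [folklore] -/
private theorem smul_barlowOffset_add_layerNormal_mem {α : ℝ} :
    α • barlowOffset 2 + layerNormal layerSpacing ∈ layerShell α α :=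
  mem_layerShell_iff.2 (Or.inr (Or.inl (by
    rw [add_sub_cancel_right, mem_holeTriple_iff]
    exact ⟨barlowOffset 2, mem_holeTriple_one_iff.2 (Or.inl rfl), rfl⟩)))

/-- … whose antipode is NOT in the shell: **anticuboctahedra are not centrally symmetric.**
[cite: HalesDSP2012, §1.3 (Fig. 1.11)] -/
theorem neg_smul_barlowOffset_add_layerNormal_not_mem {α : ℝ} (hα : α = 1 ∨ α = -1) :
    -(α • barlowOffset 2 + layerNormal layerSpacing) ∉ layerShell α α := by
  rw [neg_mem_layerShell_hcp_iff hα smul_barlowOffset_add_layerNormal_mem]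
  intro h
  have := apply_two_of_mem_hexagonSet h
  simp at this
  exact layerSpacing_pos.ne' this

/-! ### Linear isometries between layer shells (spacing `2`) -/

section ShellIsometries

variable (M : EuclideanSpace ℝ (Fin 3) ≃ₗᵢ[ℝ] EuclideanSpace ℝ (Fin 3))

/-- The inverse image identity: `M '' A = B → M.symm '' B = A`. [folklore] -/
private theorem symm_image_eq_of_image_eq {A B : Set (EuclideanSpace ℝ (Fin 3))} (h : M '' A = B) :
    M.symm '' B = A := by
  rw [← h, Set.image_image]
  simp

/-- **No linear isometry carries an anticuboctahedron onto a cuboctahedron** (the latter is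
centrally symmetric, the former is not). [cite: HalesDSP2012, §1.3 (Fig. 1.11)] -/
theorem image_layerShell_hcp_ne_fcc {α α' : ℝ} (hα' : α' = 1 ∨ α' = -1) :
    M '' layerShell α' α' ≠ layerShell α (-α) := by
  intro h
  apply neg_smul_barlowOffset_add_layerNormal_not_mem hα'
  set z := α' • barlowOffset 2 + layerNormal layerSpacing
  have hz : M z ∈ layerShell α (-α) := h ▸ Set.mem_image_of_mem _ smul_barlowOffset_add_layerNormal_mem
  have hnz : M (-z) ∈ M '' layerShell α' α' := by
    rw [h, map_neg]; exact neg_mem_layerShell_neg hz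
  obtain ⟨y, hy, hyz⟩ := hnz
  rwa [← M.injective hyz]

/-- **No linear isometry carries a cuboctahedron onto an anticuboctahedron.**
[cite: HalesDSP2012, §1.3 (Fig. 1.11)] -/
theorem image_layerShell_fcc_ne_hcp {α α' : ℝ} (hα : α = 1 ∨ α = -1) :
    M '' layerShell α' (-α') ≠ layerShell α α := by
  intro h
  exact image_layerShell_hcp_ne_fcc M.symm hα (symm_image_eq_of_image_eq M h)

variable {M}

/-- An isometry between two anticuboctahedra maps hexagon vectors to hexagon vectors (they are
the vectors with an antipode in the shell). [cite: HalesDSP2012, §1.3 (Fig. 1.11: "a uniquely determined plane of reflectional symmetry, containing six of the twelve points")] -/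
theorem image_hexagonSet_subset_of_image_layerShell_hcp {α α' : ℝ} (hα : α = 1 ∨ α = -1)
    (hα' : α' = 1 ∨ α' = -1) (h : M '' layerShell α' α' = layerShell α α) :
    M '' hexagonSet ⊆ hexagonSet := by
  rintro _ ⟨x, hx, rfl⟩
  have hxA : x ∈ layerShell α' α' := hexagonSet_subset_layerShell _ _ hx
  have h1 : M x ∈ layerShell α α := h ▸ Set.mem_image_of_mem _ hxA
  have h2 : -M x ∈ layerShell α α := by
    rw [← map_neg, ← h]
    exact Set.mem_image_of_mem _ ((neg_mem_layerShell_hcp_iff hα' hxA).2 hx)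
  exact (neg_mem_layerShell_hcp_iff hα h1).1 h2

/-- … hence onto the hexagon. [cite: HalesDSP2012, §1.3 (Fig. 1.11: the uniquely determined plane of symmetry)] -/
theorem image_hexagonSet_eq_of_image_layerShell_hcp {α α' : ℝ} (hα : α = 1 ∨ α = -1)
    (hα' : α' = 1 ∨ α' = -1) (h : M '' layerShell α' α' = layerShell α α) :
    M '' hexagonSet = hexagonSet := by
  refine Set.Subset.antisymm (image_hexagonSet_subset_of_image_layerShell_hcp hα hα' h) ?_
  intro y hy
  have hy' : M.symm y ∈ hexagonSet :=
    image_hexagonSet_subset_of_image_layerShell_hcp hα' hα (symm_image_eq_of_image_eq M h)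
      (Set.mem_image_of_mem _ hy)
  exact ⟨M.symm y, hy', by simp⟩

/-- The inner product with the interlayer vector reads off the third coordinate. [folklore] -/
private theorem inner_layerNormal_left (x : EuclideanSpace ℝ (Fin 3)) :
    ⟪layerNormal layerSpacing, x⟫ = layerSpacing * x 2 := by
  rw [inner_fin3]; simp

/-- An isometry between two anticuboctahedra maps the stacking axis to itself up to sign (it
preserves the hexagon, hence its plane, hence the normal line). [cite: HalesDSP2012, §1.3 (Fig. 1.11: the uniquely determined plane of symmetry, hence axis)] -/
theorem map_layerNormal_of_image_layerShell_hcp {α α' : ℝ} (hα : α = 1 ∨ α = -1)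
    (hα' : α' = 1 ∨ α' = -1) (h : M '' layerShell α' α' = layerShell α α) :
    M (layerNormal layerSpacing) = layerNormal layerSpacing ∨
      M (layerNormal layerSpacing) = -layerNormal layerSpacing := by
  have hH := image_hexagonSet_eq_of_image_layerShell_hcp hα hα' h
  -- `M 𝐞` is orthogonal to every hexagon vector
  have horth : ∀ y ∈ hexagonSet, ⟪M (layerNormal layerSpacing), y⟫ = 0 := by
    intro y hy
    obtain ⟨x, hx, rfl⟩ := hH.symm ▸ hy
    rw [LinearIsometryEquiv.inner_map_map, inner_layerNormal_left, apply_two_of_mem_hexagonSet hx,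
      mul_zero]
  have hu := horth (triangularVec₁ 2) (by simp [hexagonSet])
  have hv := horth (triangularVec₂ 2) (by simp [hexagonSet])
  rw [inner_fin3] at hu hv
  simp [triangularVec₁, triangularVec₂] at hu hv
  have h0 : M (layerNormal layerSpacing) 0 = 0 := by linarith
  have h1 : M (layerNormal layerSpacing) 1 = 0 := by
    have h3 : Real.sqrt 3 ≠ 0 := by positivity
    rw [h0] at hv
    simpa [h3] using hv
  -- its norm is `𝗁`, so the third coordinate is `±𝗁`
  have hn : ‖M (layerNormal layerSpacing)‖ ^ 2 = layerSpacing ^ 2 := by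
    rw [LinearIsometryEquiv.norm_map, norm_sq_fin3]; simp [layerNormal]
  rw [norm_sq_fin3, h0, h1] at hn
  have h2 : M (layerNormal layerSpacing) 2 = layerSpacing ∨
      M (layerNormal layerSpacing) 2 = -layerSpacing := by
    have : (M (layerNormal layerSpacing) 2 - layerSpacing) *
        (M (layerNormal layerSpacing) 2 + layerSpacing) = 0 := by nlinarith
    rcases mul_eq_zero.1 this with h | h
    · left; linarith
    · right; linarith
  rcases h2 with h2 | h2
  · left; ext n; fin_cases n <;> simp [h0, h1, h2]
  · right; ext n; fin_cases n <;> simp [h0, h1, h2]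

/-- The same, with the sign as a scalar: `M (𝗁e₃) = ε (𝗁e₃)`, `ε = ±1`. [folklore] -/
private theorem exists_map_layerNormal_eq_smul {α α' : ℝ} (hα : α = 1 ∨ α = -1)
    (hα' : α' = 1 ∨ α' = -1) (h : M '' layerShell α' α' = layerShell α α) :
    ∃ ε : ℝ, (ε = 1 ∨ ε = -1) ∧ M (layerNormal layerSpacing) = ε • layerNormal layerSpacing := by
  rcases map_layerNormal_of_image_layerShell_hcp hα hα' h with h1 | h1
  · exact ⟨1, Or.inl rfl, by rw [h1, one_smul]⟩
  · exact ⟨-1, Or.inr rfl, by rw [h1, neg_one_smul]⟩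

/-- An isometry fixing the axis up to sign maps horizontal vectors to horizontal vectors.
[folklore] -/
private theorem apply_two_map_eq_zero {ε : ℝ} (hε : M (layerNormal layerSpacing) = ε • layerNormal layerSpacing)
    (hε1 : ε = 1 ∨ ε = -1) {x : EuclideanSpace ℝ (Fin 3)} (hx : x 2 = 0) : (M x) 2 = 0 := by
  have h := M.inner_map_map (layerNormal layerSpacing) x
  rw [hε, real_inner_smul_left, inner_layerNormal_left, inner_layerNormal_left, hx, mul_zero]
    at h
  have hε0 : ε ≠ 0 := by rcases hε1 with rfl | rfl <;> norm_num
  have : ε * layerSpacing ≠ 0 := mul_ne_zero hε0 layerSpacing_pos.ne'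
  have h' : (ε * layerSpacing) * (M x) 2 = 0 := by rw [mul_assoc]; exact h
  exact (mul_eq_zero.1 h').resolve_left this

/-- **Cap transport.** An isometry between two anticuboctahedra `layerShell α' α' → layerShell α α`
carries the hole triple `holeTriple α'` into `holeTriple α` (the caps go to caps, and the image
of a horizontal vector is horizontal). [folklore] -/
private theorem image_holeTriple_subset_of_image_layerShell_hcp {α α' : ℝ}
    (h : M '' layerShell α' α' = layerShell α α) {ε : ℝ}
    (hε : M (layerNormal layerSpacing) = ε • layerNormal layerSpacing) (hε1 : ε = 1 ∨ ε = -1) :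
    M '' holeTriple α' ⊆ holeTriple α := by
  rintro _ ⟨t, ht, rfl⟩
  have htA : t + layerNormal layerSpacing ∈ layerShell α' α' :=
    mem_layerShell_iff.2 (Or.inr (Or.inl (by simpa using ht)))
  have h1 : M t + ε • layerNormal layerSpacing ∈ layerShell α α := by
    rw [← hε, ← map_add, ← h]; exact Set.mem_image_of_mem _ htA
  have ht2 : (M t) 2 = 0 := apply_two_map_eq_zero hε hε1 (apply_two_of_mem_holeTriple ht)
  have hne : layerSpacing ≠ 0 := layerSpacing_pos.ne'
  rcases mem_layerShell_iff.1 h1 with h2 | h2 | h2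
  · exfalso
    have := apply_two_of_mem_hexagonSet h2
    simp [ht2] at this
    rcases hε1 with rfl | rfl <;> simp at this <;> exact hne this
  · have := apply_two_of_mem_holeTriple h2
    simp [ht2] at this
    rcases hε1 with rfl | rfl
    · simpa using h2
    · exfalso; apply hne; linarith
  · have := apply_two_of_mem_holeTriple h2
    simp [ht2] at this
    rcases hε1 with rfl | rfl
    · exfalso; apply hne; linarith
    · simpa using h2

/-- Cap transport for the opposite triple: `M (holeTriple (−α')) ⊆ holeTriple (−α)` (negate).
[folklore] -/
private theorem image_holeTriple_neg_subset_of_image_layerShell_hcp {α α' : ℝ}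
    (h : M '' layerShell α' α' = layerShell α α) {ε : ℝ}
    (hε : M (layerNormal layerSpacing) = ε • layerNormal layerSpacing) (hε1 : ε = 1 ∨ ε = -1) :
    M '' holeTriple (-α') ⊆ holeTriple (-α) := by
  rintro _ ⟨t, ht, rfl⟩
  have hnt : -t ∈ holeTriple α' := neg_mem_holeTriple_iff.2 ht
  have h1 : M (-t) ∈ holeTriple α :=
    image_holeTriple_subset_of_image_layerShell_hcp h hε hε1 (Set.mem_image_of_mem _ hnt)
  rw [map_neg] at h1
  exact neg_mem_holeTriple_iff.1 h1

/-- Cap transport for either letter `s = ±1`: `M (holeTriple s) ⊆ holeTriple (α α' s)`. [folklore] -/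
private theorem image_holeTriple_subset_of_image_layerShell_hcp' {α α' : ℝ}
    (hα' : α' = 1 ∨ α' = -1) (h : M '' layerShell α' α' = layerShell α α) {ε : ℝ}
    (hε : M (layerNormal layerSpacing) = ε • layerNormal layerSpacing) (hε1 : ε = 1 ∨ ε = -1)
    {s : ℝ} (hs : s = 1 ∨ s = -1) : M '' holeTriple s ⊆ holeTriple (α * α' * s) := by
  have hsq : α' * α' = 1 := by rcases hα' with rfl | rfl <;> norm_num
  rcases (show s = α' ∨ s = -α' by
      rcases hα' with rfl | rfl <;> rcases hs with rfl | rfl <;> norm_num) with rfl | rfl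
  · rw [mul_assoc, hsq, mul_one]
    exact image_holeTriple_subset_of_image_layerShell_hcp h hε hε1
  · rw [mul_neg, mul_assoc, hsq, mul_one]
    exact image_holeTriple_neg_subset_of_image_layerShell_hcp h hε hε1

/-- **Transport of all four layer shells.** An isometry `M` between two anticuboctahedra
`layerShell α' α' → layerShell α α` carries every layer shell `layerShell a b` (`a, b = ±1`) ONTO
the layer shell with letters `α α' a`, `α α' b` — in this order if `M` fixes the axis vector
(`ε = 1`), swapped if `M` reverses it (`ε = −1`). [cite: HalesDSP2012, §1.3 (Fig. 1.11–1.12)] -/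
theorem image_layerShell_eq_of_image_layerShell_hcp {α α' : ℝ} (hα : α = 1 ∨ α = -1)
    (hα' : α' = 1 ∨ α' = -1) (h : M '' layerShell α' α' = layerShell α α) {ε : ℝ}
    (hε : M (layerNormal layerSpacing) = ε • layerNormal layerSpacing) (hε1 : ε = 1 ∨ ε = -1)
    {a b : ℝ} (ha : a = 1 ∨ a = -1) (hb : b = 1 ∨ b = -1) :
    M '' layerShell a b =
      if ε = 1 then layerShell (α * α' * a) (α * α' * b)
      else layerShell (α * α' * b) (α * α' * a) := by
  have hH := image_hexagonSet_subset_of_image_layerShell_hcp hα hα' h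
  have hpm : ∀ {c : ℝ}, (c = 1 ∨ c = -1) → (α * α' * c = 1 ∨ α * α' * c = -1) := by
    intro c hc
    rcases hα with rfl | rfl <;> rcases hα' with rfl | rfl <;> rcases hc with rfl | rfl <;> norm_num
  -- inclusion
  have hsub : M '' layerShell a b ⊆
      if ε = 1 then layerShell (α * α' * a) (α * α' * b)
      else layerShell (α * α' * b) (α * α' * a) := by
    rintro _ ⟨x, hx, rfl⟩
    rcases mem_layerShell_iff.1 hx with h1 | h1 | h1
    · have hMx : M x ∈ hexagonSet := hH (Set.mem_image_of_mem _ h1)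
      split_ifs
      · exact hexagonSet_subset_layerShell _ _ hMx
      · exact hexagonSet_subset_layerShell _ _ hMx
    · -- upper cap: `x = t + 𝐞`
      have hMt : M (x - layerNormal layerSpacing) ∈ holeTriple (α * α' * a) :=
        image_holeTriple_subset_of_image_layerShell_hcp' hα' h hε hε1 ha
          (Set.mem_image_of_mem _ h1)
      rw [map_sub, hε] at hMt
      rcases hε1 with rfl | rfl
      · rw [if_pos rfl, one_smul] at *
        exact mem_layerShell_iff.2 (Or.inr (Or.inl hMt))
      · rw [if_neg (by norm_num : (-1 : ℝ) ≠ 1)]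
        rw [neg_one_smul, sub_neg_eq_add] at hMt
        exact mem_layerShell_iff.2 (Or.inr (Or.inr hMt))
    · -- lower cap: `x = t − 𝐞`
      have hMt : M (x + layerNormal layerSpacing) ∈ holeTriple (α * α' * b) :=
        image_holeTriple_subset_of_image_layerShell_hcp' hα' h hε hε1 hb
          (Set.mem_image_of_mem _ h1)
      rw [map_add, hε] at hMt
      rcases hε1 with rfl | rfl
      · rw [if_pos rfl, one_smul] at *
        exact mem_layerShell_iff.2 (Or.inr (Or.inr hMt))
      · rw [if_neg (by norm_num : (-1 : ℝ) ≠ 1)]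
        rw [neg_one_smul, ← sub_eq_add_neg] at hMt
        exact mem_layerShell_iff.2 (Or.inr (Or.inl hMt))
  -- equality by counting: both sides have twelve points
  refine Set.eq_of_subset_of_ncard_le hsub ?_ ?_
  · rw [Set.ncard_image_of_injective _ M.injective, ncard_layerShell ha hb]
    split_ifs
    · rw [ncard_layerShell (hpm ha) (hpm hb)]
    · rw [ncard_layerShell (hpm hb) (hpm ha)]
  · split_ifs <;> exact finite_layerShell _ _

/-- **The two cuboctahedra seen from an anticuboctahedron.** If `M` carries `layerShell α' α'`
onto `layerShell α α`, then it carries the pair of cuboctahedra (`layerShell α' (−α')`,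
`layerShell (−α') α'`) onto the pair (`layerShell α (−α)`, `layerShell (−α) α`), in this order or
swapped. [cite: HalesDSP2012, §1.3 (Fig. 1.11–1.12)] -/
theorem image_layerShell_fcc_of_image_layerShell_hcp {α α' : ℝ} (hα : α = 1 ∨ α = -1)
    (hα' : α' = 1 ∨ α' = -1) (h : M '' layerShell α' α' = layerShell α α) :
    (M '' layerShell α' (-α') = layerShell α (-α) ∧
        M '' layerShell (-α') α' = layerShell (-α) α) ∨
      (M '' layerShell α' (-α') = layerShell (-α) α ∧
        M '' layerShell (-α') α' = layerShell α (-α)) := by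
  obtain ⟨ε, hε1, hε⟩ := exists_map_layerNormal_eq_smul hα hα' h
  have hnα' : -α' = 1 ∨ -α' = -1 := by rcases hα' with rfl | rfl <;> norm_num
  have hsq : α * α' * α' = α := by
    rw [mul_assoc]; rcases hα' with rfl | rfl <;> norm_num
  have hsq' : α * α' * -α' = -α := by rw [mul_neg, hsq]
  have e1 := image_layerShell_eq_of_image_layerShell_hcp hα hα' h hε hε1 hα' hnα'
  have e2 := image_layerShell_eq_of_image_layerShell_hcp hα hα' h hε hε1 hnα' hα'
  rw [hsq, hsq'] at e1 e2
  rcases hε1 with rfl | rfl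
  · left; exact ⟨by simpa using e1, by simpa using e2⟩
  · right
    exact ⟨by simpa [show (-1 : ℝ) ≠ 1 by norm_num] using e1,
      by simpa [show (-1 : ℝ) ≠ 1 by norm_num] using e2⟩

end ShellIsometries

/-! ## §4 The shells of the close-packed stackings at unit spacing; the fcc lattice is generated
by its shell -/

/-- **The touching neighbours of a site of a close-packed stacking form a Barlow shell**: for a
Hägg sequence `s` and the site `p = barlowPos 1 √(2/3) s k i j`, the points of
`barlowStacking 1 √(2/3) s` at distance `1` from `p` are `p + barlowShell (s k) (−s (k−1))` — the
layer above is shifted by the letter `s k`, the layer below by `−s (k−1)` (Hales, DSP §1.3, via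
`kissingShell_barlowStacking_eq_layerShell`). [cite: HalesDSP2012, §1.3 (Fig. 1.12)] -/
theorem touching_barlowStacking_eq_image_barlowShell {s : ℤ → ℤ} (hs : IsHaggSeq s) (k i j : ℤ) :
    {x | x ∈ barlowStacking 1 (Real.sqrt (2 / 3)) s ∧
        dist x (barlowPos 1 (Real.sqrt (2 / 3)) s k i j) = 1} =
      (fun v => barlowPos 1 (Real.sqrt (2 / 3)) s k i j + v) ''
        barlowShell (s k : ℝ) (-((s (k - 1) : ℤ) : ℝ)) := by
  have key := kissingShell_barlowStacking_eq_layerShell hs k i j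
  set p := barlowPos 1 (Real.sqrt (2 / 3)) s k i j with hp
  have hu : barlowPos 2 layerSpacing s k i j = (2 : ℝ) • p := barlowPos_two_layerSpacing s k i j
  ext x
  constructor
  · rintro ⟨hx, hd⟩
    refine ⟨x - p, ?_, by abel⟩
    rw [mem_barlowShell_iff, ← key, mem_kissingShell_iff, hu, ← smul_add, add_sub_cancel,
      norm_smul, Real.norm_two, ← dist_eq_norm, hd, mul_one]
    exact ⟨mem_barlowStacking_one_iff.1 hx, rfl⟩
  · rintro ⟨v, hv, rfl⟩
    rw [mem_barlowShell_iff, ← key, mem_kissingShell_iff, hu, ← smul_add, norm_smul,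
      Real.norm_two] at hv
    refine ⟨mem_barlowStacking_one_iff.2 hv.1, ?_⟩
    rw [dist_eq_norm, add_sub_cancel_left]
    linarith [hv.2]

/-- The origin is the site `(0, 0, 0)` of every stacking. [folklore] -/
private theorem barlowPos_zero_zero_zero (a c : ℝ) (s : ℤ → ℤ) : barlowPos a c s 0 0 0 = 0 := by
  simp [barlowPos]

/-- **The unit neighbours of the origin in the fcc host `Λ₀ = fccStacking 1 √(2/3)` form the
cuboctahedron `barlowShell 1 (−1)`.** [cite: HalesDSP2012, §1.3 (p. 12, the FCC pattern)] -/
theorem barlowShell_one_neg_one_eq :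
    barlowShell 1 (-1) = {v | v ∈ fccHost ∧ ‖v‖ = 1} := by
  have h := touching_barlowStacking_eq_image_barlowShell isHaggSeq_const 0 0 0
  rw [barlowPos_zero_zero_zero] at h
  simp only [constHagg, Int.cast_one, zero_add, Set.image_id', dist_zero_right] at h
  exact h.symm

/-- **The unit neighbours of the origin in the hcp stacking `hcpStacking 1 √(2/3)` form the
anticuboctahedron `barlowShell 1 1`.** [cite: HalesDSP2012, §1.3 (p. 12, the HCP pattern)] -/
theorem barlowShell_one_one_eq :
    barlowShell 1 1 = {v | v ∈ hcpStacking 1 (Real.sqrt (2 / 3)) ∧ ‖v‖ = 1} := by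
  have h := touching_barlowStacking_eq_image_barlowShell isHaggSeq_alternating 0 0 0
  rw [barlowPos_zero_zero_zero, alternatingHagg_sub_one] at h
  simp only [alternatingHagg, Even.zero, if_true, Int.cast_one, Int.cast_neg, neg_neg, zero_add,
    Set.image_id', dist_zero_right] at h
  exact h.symm

/-- Shell vectors of the cuboctahedron are fcc host vectors. [cite: HalesDSP2012, §1.3 (p. 12, the FCC packing)] -/
theorem barlowShell_one_neg_one_subset_fccHost : barlowShell 1 (-1) ⊆ fccHost := by
  rw [barlowShell_one_neg_one_eq]; exact fun v hv => hv.1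

/-- Shell vectors have norm `1` (letters `±1`). [cite: HalesDSP2012, §1.3 (pp. 12–13: unit balls, touching centres at distance 2)] -/
theorem norm_eq_one_of_mem_barlowShell {σ τ : ℝ} (hσ : σ = 1 ∨ σ = -1) (hτ : τ = 1 ∨ τ = -1)
    {v : EuclideanSpace ℝ (Fin 3)} (hv : v ∈ barlowShell σ τ) : ‖v‖ = 1 := by
  rw [mem_barlowShell_iff, mem_layerShell_iff] at hv
  have h4 : ⟪(2 : ℝ) • v, (2 : ℝ) • v⟫ = 4 := by
    rcases hv with h | h | h
    · exact inner_self_of_mem_hexagonSet h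
    · have ht := inner_self_of_mem_holeTriple hσ h
      have h0 : ⟪(2 : ℝ) • v - layerNormal layerSpacing, layerNormal layerSpacing⟫ = 0 := by
        rw [real_inner_comm, inner_layerNormal_left, apply_two_of_mem_holeTriple h, mul_zero]
      have : (2 : ℝ) • v = ((2 : ℝ) • v - layerNormal layerSpacing) + layerNormal layerSpacing := by
        abel
      rw [this, real_inner_add_add_self, ht, h0, inner_frameE_frameE]; norm_num
    · have ht := inner_self_of_mem_holeTriple hτ h
      have h0 : ⟪(2 : ℝ) • v + layerNormal layerSpacing, layerNormal layerSpacing⟫ = 0 := by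
        rw [real_inner_comm, inner_layerNormal_left, apply_two_of_mem_holeTriple h, mul_zero]
      have : (2 : ℝ) • v = ((2 : ℝ) • v + layerNormal layerSpacing) - layerNormal layerSpacing := by
        abel
      rw [this, real_inner_sub_sub_self, ht, h0, inner_frameE_frameE]; norm_num
  have h2 : ‖(2 : ℝ) • v‖ = 2 := norm_eq_two_iff_inner.2 h4
  rw [norm_smul, Real.norm_two] at h2
  linarith

/-- The three generators `u = (1,0,0)`, `v = (½, √3/2, 0)`, `w + √(2/3) e₃` of the fcc host are
shell vectors. [folklore] -/
private theorem generators_mem_barlowShell :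
    triangularVec₁ 1 ∈ barlowShell 1 (-1) ∧ triangularVec₂ 1 ∈ barlowShell 1 (-1) ∧
      barlowOffset 1 + layerNormal (Real.sqrt (2 / 3)) ∈ barlowShell 1 (-1) := by
  have e1 : (2 : ℝ) • triangularVec₁ 1 = triangularVec₁ 2 := by
    ext n; fin_cases n <;> simp [triangularVec₁]
  have e2 : (2 : ℝ) • triangularVec₂ 1 = triangularVec₂ 2 := by
    ext n; fin_cases n
    · norm_num [triangularVec₂]
    · simp [triangularVec₂]; ring
    · simp [triangularVec₂]
  have e3 : (2 : ℝ) • (barlowOffset 1 + layerNormal (Real.sqrt (2 / 3))) =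
      barlowOffset 2 + layerNormal layerSpacing := by
    ext n; fin_cases n
    · norm_num [barlowOffset, layerNormal]
    · simp [barlowOffset, layerNormal]; ring
    · simp [barlowOffset, layerNormal, layerSpacing]
  refine ⟨?_, ?_, ?_⟩
  · rw [mem_barlowShell_iff, e1]
    exact hexagonSet_subset_layerShell _ _ (by simp [hexagonSet])
  · rw [mem_barlowShell_iff, e2]
    exact hexagonSet_subset_layerShell _ _ (by simp [hexagonSet])
  · rw [mem_barlowShell_iff, e3, mem_layerShell_iff]
    exact Or.inr (Or.inl (by rw [add_sub_cancel_right, mem_holeTriple_one_iff]; exact Or.inl rfl))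

/-- **The fcc host is the lattice generated by its twelve shell vectors**:
`Λ₀ = ℤ·barlowShell 1 (−1)` (`Λ₀` is an additive subgroup — `fccStacking_eq_coe_addSubgroup` —
containing the shell, and its sites `i u + j v + k (w + √(2/3) e₃)` are integer combinations of
three shell vectors). [cite: ConwaySloane1999, Ch. 4 §6.3 (D₃ = fcc generated by its minimal
vectors)] -/
theorem fccHost_eq_closure_barlowShell :
    (fccHost : Set (EuclideanSpace ℝ (Fin 3))) =
      (AddSubgroup.closure (barlowShell 1 (-1)) : Set (EuclideanSpace ℝ (Fin 3))) := by
  have hh : Real.sqrt (2 / 3) ≠ 0 := by positivity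
  obtain ⟨Λ, hΛ⟩ :=
    Literature.Barriers.AtomisticToContinuum.fccStacking_eq_coe_addSubgroup (a := (1 : ℝ))
      (h := Real.sqrt (2 / 3)) one_ne_zero hh
  apply Set.Subset.antisymm
  · rintro x ⟨k, i, j, rfl⟩
    obtain ⟨hu, hv, hw⟩ := generators_mem_barlowShell
    have hx : barlowPos 1 (Real.sqrt (2 / 3)) constHagg k i j =
        (i : ℤ) • triangularVec₁ 1 + (j : ℤ) • triangularVec₂ 1 +
          (k : ℤ) • (barlowOffset 1 + layerNormal (Real.sqrt (2 / 3))) := by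
      simp only [barlowPos, haggLabel_const, ← Int.cast_smul_eq_zsmul ℝ, smul_add]
      abel
    rw [hx]
    refine AddSubgroup.add_mem _ (AddSubgroup.add_mem _ ?_ ?_) ?_
    · exact AddSubgroup.zsmul_mem _ (AddSubgroup.subset_closure hu) _
    · exact AddSubgroup.zsmul_mem _ (AddSubgroup.subset_closure hv) _
    · exact AddSubgroup.zsmul_mem _ (AddSubgroup.subset_closure hw) _
  · change ((AddSubgroup.closure (barlowShell 1 (-1)) : Set _) ⊆ fccStacking 1 (Real.sqrt (2 / 3)))
    rw [← hΛ]
    exact (AddSubgroup.closure_le _).2 (hΛ ▸ barlowShell_one_neg_one_subset_fccHost)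

/-- The image of the fcc host under a linear isometry is the lattice generated by the image of
the shell. [cite: ConwaySloane1999, Ch. 4 §6.3 (fcc = D₃, generated by its minimal vectors)] -/
theorem image_fccHost_eq_closure (F : EuclideanSpace ℝ (Fin 3) ≃ₗᵢ[ℝ] EuclideanSpace ℝ (Fin 3)) :
    F '' fccHost = (AddSubgroup.closure (F '' barlowShell 1 (-1)) : Set (EuclideanSpace ℝ (Fin 3))) := by
  rw [fccHost_eq_closure_barlowShell]
  have h := AddMonoidHom.map_closure F.toLinearEquiv.toLinearMap.toAddMonoidHom (barlowShell 1 (-1))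
  have hc : ⇑(F.toLinearEquiv.toLinearMap.toAddMonoidHom) = ⇑F := rfl
  rw [← hc, ← AddSubgroup.coe_map, h]

/-- **The orientation class of a frame is determined by its shell**: two frames carrying the
reference cuboctahedron to the same twelve points carry the fcc host `Λ₀` to the same rotated
lattice. [cite: ConwaySloane1999, Ch. 4 §6.3 (fcc = D₃, generated by its minimal vectors)] -/
theorem image_fccHost_eq_of_image_barlowShell_eq
    {F F' : EuclideanSpace ℝ (Fin 3) ≃ₗᵢ[ℝ] EuclideanSpace ℝ (Fin 3)}
    (h : F '' barlowShell 1 (-1) = F' '' barlowShell 1 (-1)) : F '' fccHost = F' '' fccHost := by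
  rw [image_fccHost_eq_closure, image_fccHost_eq_closure, h]

/-! ## §5 The half-turn on shells; letter frames -/

/-- The half-turn carries the layer shell of letters `(a, b)` into the one of letters `(−a, −b)`
(it negates the hexagon and the hole triples and fixes the heights). [folklore] -/
private theorem rotPi_mem_layerShell {a b : ℝ} {x : EuclideanSpace ℝ (Fin 3)} (hx : x ∈ layerShell a b) :
    rotPi x ∈ layerShell (-a) (-b) := by
  rcases mem_layerShell_iff.1 hx with h | h | h
  · rw [rotPi_of_apply_two_eq_zero (apply_two_of_mem_hexagonSet h)]
    exact hexagonSet_subset_layerShell _ _ (neg_mem_hexagonSet h)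
  · refine mem_layerShell_iff.2 (Or.inr (Or.inl ?_))
    have : rotPi x - layerNormal layerSpacing = rotPi (x - layerNormal layerSpacing) := by
      rw [map_sub, rotPi_layerNormal]
    rw [this, rotPi_of_apply_two_eq_zero (apply_two_of_mem_holeTriple h), neg_mem_holeTriple_iff,
      neg_neg]
    exact h
  · refine mem_layerShell_iff.2 (Or.inr (Or.inr ?_))
    have : rotPi x + layerNormal layerSpacing = rotPi (x + layerNormal layerSpacing) := by
      rw [map_add, rotPi_layerNormal]
    rw [this, rotPi_of_apply_two_eq_zero (apply_two_of_mem_holeTriple h), neg_mem_holeTriple_iff,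
      neg_neg]
    exact h

/-- `R_π (layerShell a b) = layerShell (−a) (−b)`. [cite: HalesDSP2012, §1.3 (Fig. 1.11: "the top layer of the HCP pattern is rotated 60 degrees with respect to the FCC pattern")] -/
theorem image_rotPi_layerShell (a b : ℝ) : rotPi '' layerShell a b = layerShell (-a) (-b) := by
  refine Set.Subset.antisymm ?_ ?_
  · rintro _ ⟨x, hx, rfl⟩; exact rotPi_mem_layerShell hx
  · intro y hy
    refine ⟨rotPi y, ?_, rotPi_rotPi y⟩
    have := rotPi_mem_layerShell hy
    rwa [neg_neg, neg_neg] at this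

/-- `R_π (barlowShell a b) = barlowShell (−a) (−b)`: the half-turn exchanges the letters.
[cite: HalesDSP2012, §1.3 (Fig. 1.11: rotated 60 degrees)] -/
theorem image_rotPi_barlowShell (a b : ℝ) : rotPi '' barlowShell a b = barlowShell (-a) (-b) := by
  have h := image_barlowShell_eq (σ := a) (τ := b) rotPi.toLinearEquiv.toLinearMap
  have hc : ⇑(rotPi.toLinearEquiv.toLinearMap) = ⇑rotPi := rfl
  rw [hc] at h
  rw [h, image_rotPi_layerShell, barlowShell]

/-- **The letter frame** `M_σ`: the identity for the letter `σ = 1`, the half-turn `R_π` for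
`σ = −1`; it carries the reference cuboctahedron `barlowShell 1 (−1)` (shell of `Λ₀`) to the
cuboctahedron `barlowShell σ (−σ)` of up-letter `σ`, and `Λ₀` to the cubic lattice `M_σ Λ₀` whose
stacking along `e₃` has all Hägg letters `σ` (`Λ₀` itself, or its twin `R_π Λ₀`). [folklore] -/
def letterFrame (σ : ℝ) : EuclideanSpace ℝ (Fin 3) ≃ₗᵢ[ℝ] EuclideanSpace ℝ (Fin 3) :=
  if σ = 1 then LinearIsometryEquiv.refl ℝ _ else rotPi

/-- `M_1 = 1`. [folklore] -/
@[simp] private theorem letterFrame_one : letterFrame 1 = LinearIsometryEquiv.refl ℝ _ := by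
  simp [letterFrame]

/-- `M_{−1} = R_π`. [folklore] -/
@[simp] private theorem letterFrame_neg_one : letterFrame (-1) = rotPi := by
  simp [letterFrame, show (-1 : ℝ) ≠ 1 by norm_num]

/-- `M_σ (barlowShell 1 (−1)) = barlowShell σ (−σ)` for `σ = ±1`. [cite: HalesDSP2012, §1.3 (Fig. 1.11–1.12)] -/
theorem image_letterFrame_barlowShell {σ : ℝ} (hσ : σ = 1 ∨ σ = -1) :
    letterFrame σ '' barlowShell 1 (-1) = barlowShell σ (-σ) := by
  rcases hσ with rfl | rfl
  · simp
  · rw [letterFrame_neg_one, image_rotPi_barlowShell, neg_neg]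

/-! ## §6 Barlow shells of a configuration: the per-ball predicates -/

/-- **`BarlowShellAt X p L σ τ`: the ball `p` has a Barlow shell in `X`, with frame `L` and
letters `(σ, τ)`** — `σ, τ ∈ {1, −1}` and the points of `X` at distance exactly `1` from `p` (the
balls touching `p`, for a hard-sphere configuration of unit diameter) are exactly the twelve
points `p + L(barlowShell σ τ)`: a rotated cuboctahedron (`τ = −σ`, FCC-type site) or
anticuboctahedron (`τ = σ`, HCP-type site). The frame `L ∈ O(3)` maps the reference stacking axis
`e₃` and the reference triangular layer to those of the shell. Membership `p ∈ X` is not required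
by the predicate (it holds in the intended use, `p` ranging over `X`).
[cite: HalesDSP2012, §1.3 ("the tangent arrangement around each ball is the FCC or HCP arrangement")] -/
def BarlowShellAt (X : Set (EuclideanSpace ℝ (Fin 3))) (p : EuclideanSpace ℝ (Fin 3))
    (L : EuclideanSpace ℝ (Fin 3) ≃ₗᵢ[ℝ] EuclideanSpace ℝ (Fin 3)) (σ τ : ℝ) : Prop :=
  (σ = 1 ∨ σ = -1) ∧ (τ = 1 ∨ τ = -1) ∧
    {x | x ∈ X ∧ dist x p = 1} = (fun v => p + L v) '' barlowShell σ τ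

/-- `p` is a **Barlow-crystallized** point of `X`: it has a Barlow shell for some frame and
letters. [cite: HalesDSP2012, §1.3] -/
def IsBarlowAt (X : Set (EuclideanSpace ℝ (Fin 3))) (p : EuclideanSpace ℝ (Fin 3)) : Prop :=
  ∃ (L : EuclideanSpace ℝ (Fin 3) ≃ₗᵢ[ℝ] EuclideanSpace ℝ (Fin 3)) (σ τ : ℝ), BarlowShellAt X p L σ τ

/-- `p` is an **FCC-type (cubic, `c`) site** of `X`: its shell is a cuboctahedron (letters
`(σ, −σ)`: the layers above and below are shifted in opposite registries, local stacking `ABC`).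
[cite: HalesDSP2012, §1.3 (Fig. 1.11, the FCC pattern)] -/
def IsFccTypeAt (X : Set (EuclideanSpace ℝ (Fin 3))) (p : EuclideanSpace ℝ (Fin 3)) : Prop :=
  ∃ (L : EuclideanSpace ℝ (Fin 3) ≃ₗᵢ[ℝ] EuclideanSpace ℝ (Fin 3)) (σ : ℝ), BarlowShellAt X p L σ (-σ)

/-- `p` is an **HCP-type (hexagonal, `h`) site** of `X`: its shell is an anticuboctahedron
(letters `(σ, σ)`: the layers above and below are in the same registry, local stacking `ABA`).
[cite: HalesDSP2012, §1.3 (Fig. 1.11, the HCP pattern)] -/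
def IsHcpTypeAt (X : Set (EuclideanSpace ℝ (Fin 3))) (p : EuclideanSpace ℝ (Fin 3)) : Prop :=
  ∃ (L : EuclideanSpace ℝ (Fin 3) ≃ₗᵢ[ℝ] EuclideanSpace ℝ (Fin 3)) (σ : ℝ), BarlowShellAt X p L σ σ

namespace BarlowShellAt

variable {X : Set (EuclideanSpace ℝ (Fin 3))} {p : EuclideanSpace ℝ (Fin 3)}
  {L L' : EuclideanSpace ℝ (Fin 3) ≃ₗᵢ[ℝ] EuclideanSpace ℝ (Fin 3)} {σ τ σ' τ' : ℝ}

/-- The letters of a Barlow shell are equal (HCP type) or opposite (FCC type). [cite: HalesDSP2012, §1.3 ("the FCC or HCP arrangement")] -/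
theorem letters_eq_or (h : BarlowShellAt X p L σ τ) : τ = σ ∨ τ = -σ := by
  rcases h.1 with rfl | rfl <;> rcases h.2.1 with rfl | rfl <;> norm_num

/-- A Barlow-shelled ball touches exactly twelve balls. [cite: HalesDSP2012, §1.3] -/
theorem ncard_eq (h : BarlowShellAt X p L σ τ) : {x | x ∈ X ∧ dist x p = 1}.ncard = 12 := by
  rw [h.2.2, Set.ncard_image_of_injective _ (fun v w hvw => L.injective (add_left_cancel hvw)),
    ncard_barlowShell h.1 h.2.1]

/-- The touching neighbours are at distance `1` in the shell picture: `‖L v‖ = ‖v‖ = 1`.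
[cite: HalesDSP2012, §1.3 (pp. 12–13: unit balls, touching centres at distance 2)] -/
theorem norm_eq_one (h : BarlowShellAt X p L σ τ) {v : EuclideanSpace ℝ (Fin 3)}
    (hv : v ∈ barlowShell σ τ) : ‖L v‖ = 1 := by
  rw [LinearIsometryEquiv.norm_map]; exact norm_eq_one_of_mem_barlowShell h.1 h.2.1 hv

/-- A Barlow shell is of FCC type or of HCP type. [cite: HalesDSP2012, §1.3] -/
theorem isFccTypeAt_or_isHcpTypeAt (h : BarlowShellAt X p L σ τ) :
    IsFccTypeAt X p ∨ IsHcpTypeAt X p := by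
  rcases h.letters_eq_or with h' | h'
  · exact Or.inr ⟨L, σ, h' ▸ h⟩
  · exact Or.inl ⟨L, σ, h' ▸ h⟩

end BarlowShellAt

/-- Barlow-crystallized = FCC-type or HCP-type. [cite: HalesDSP2012, §1.3] -/
theorem isBarlowAt_iff {X : Set (EuclideanSpace ℝ (Fin 3))} {p : EuclideanSpace ℝ (Fin 3)} :
    IsBarlowAt X p ↔ IsFccTypeAt X p ∨ IsHcpTypeAt X p := by
  constructor
  · rintro ⟨L, σ, τ, h⟩; exact h.isFccTypeAt_or_isHcpTypeAt
  · rintro (⟨L, σ, h⟩ | ⟨L, σ, h⟩)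
    · exact ⟨L, σ, -σ, h⟩
    · exact ⟨L, σ, σ, h⟩

/-- Translation by `p` cancels: two frames carry two shells to the same translated set iff they
carry them to the same set. [folklore] -/
private theorem image_translate_eq_iff {p : EuclideanSpace ℝ (Fin 3)}
    {L L' : EuclideanSpace ℝ (Fin 3) ≃ₗᵢ[ℝ] EuclideanSpace ℝ (Fin 3)}
    {S S' : Set (EuclideanSpace ℝ (Fin 3))} :
    (fun v => p + L v) '' S = (fun v => p + L' v) '' S' ↔ L '' S = L' '' S' := by
  have h1 : (fun v => p + L v) '' S = (fun w => p + w) '' (L '' S) := by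
    rw [Set.image_image]
  have h2 : (fun v => p + L' v) '' S' = (fun w => p + w) '' (L' '' S') := by
    rw [Set.image_image]
  rw [h1, h2, (Set.image_injective.2 (add_right_injective p)).eq_iff]

/-- … and iff the relative frame `L'⁻¹ ∘ L` carries the first shell onto the second. [folklore] -/
private theorem image_eq_image_iff_trans_symm
    {L L' : EuclideanSpace ℝ (Fin 3) ≃ₗᵢ[ℝ] EuclideanSpace ℝ (Fin 3)}
    {S S' : Set (EuclideanSpace ℝ (Fin 3))} :
    L '' S = L' '' S' ↔ (L.trans L'.symm) '' S = S' := by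
  constructor
  · intro h
    have := congrArg (fun A => L'.symm '' A) h
    simpa [Set.image_image] using this
  · intro h
    have : L' '' ((L.trans L'.symm) '' S) = L' '' S' := by rw [h]
    rw [Set.image_image] at this
    simpa using this

/-- For a linear isometry equivalence, equality of images of unit-spacing shells is equality of
images of Hales-spacing shells. [folklore] -/
private theorem image_barlowShell_eq_barlowShell_iff
    (M : EuclideanSpace ℝ (Fin 3) ≃ₗᵢ[ℝ] EuclideanSpace ℝ (Fin 3)) {σ τ σ' τ' : ℝ} :
    M '' barlowShell σ τ = barlowShell σ' τ' ↔ M '' layerShell σ τ = layerShell σ' τ' := by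
  have h := image_barlowShell_eq_iff (σ := σ) (τ := τ) (σ' := σ') (τ' := τ')
    M.toLinearEquiv.toLinearMap LinearMap.id
  have hc : ⇑(M.toLinearEquiv.toLinearMap) = ⇑M := rfl
  simpa [hc] using h

/-- **FCC type and HCP type exclude each other** (a cuboctahedron is not congruent to an
anticuboctahedron). [cite: HalesDSP2012, §1.3 (Fig. 1.11)] -/
theorem not_isFccTypeAt_of_isHcpTypeAt {X : Set (EuclideanSpace ℝ (Fin 3))}
    {p : EuclideanSpace ℝ (Fin 3)} (h : IsHcpTypeAt X p) : ¬ IsFccTypeAt X p := by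
  rintro ⟨L, σ, -, -, hS⟩
  obtain ⟨L', σ', hσ', -, hS'⟩ := h
  rw [hS', image_translate_eq_iff, image_eq_image_iff_trans_symm,
    image_barlowShell_eq_barlowShell_iff] at hS
  exact image_layerShell_hcp_ne_fcc _ hσ' hS

/-! ### Barlow shells of the perfect stackings -/

/-- **Every site of a close-packed Barlow stacking has a Barlow shell** with the identity frame
and the letters `(s k, −s (k−1))` of its two neighbouring layers.
[cite: HalesDSP2012, §1.3 (pp. 12–13)] -/
theorem barlowShellAt_barlowStacking {s : ℤ → ℤ} (hs : IsHaggSeq s) (k i j : ℤ) :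
    BarlowShellAt (barlowStacking 1 (Real.sqrt (2 / 3)) s) (barlowPos 1 (Real.sqrt (2 / 3)) s k i j)
      (LinearIsometryEquiv.refl ℝ _) (s k : ℝ) (-((s (k - 1) : ℤ) : ℝ)) := by
  refine ⟨?_, ?_, ?_⟩
  · rcases hs k with h | h <;> simp [h]
  · rcases hs (k - 1) with h | h <;> simp [h]
  · rw [touching_barlowStacking_eq_image_barlowShell hs]; rfl

/-- **Every site of the fcc host `Λ₀` is an FCC-type site** (letters `(1, −1)`, identity frame).
[cite: HalesDSP2012, §1.3 (p. 12)] -/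
theorem barlowShellAt_fccHost {p : EuclideanSpace ℝ (Fin 3)} (hp : p ∈ fccHost) :
    BarlowShellAt fccHost p (LinearIsometryEquiv.refl ℝ _) 1 (-1) := by
  obtain ⟨k, i, j, rfl⟩ := hp
  have h := barlowShellAt_barlowStacking isHaggSeq_const k i j
  simp only [constHagg, Int.cast_one] at h
  exact h

/-- Hence every site of the fcc host is of FCC type. [cite: HalesDSP2012, §1.3 (p. 12)] -/
theorem isFccTypeAt_fccHost {p : EuclideanSpace ℝ (Fin 3)} (hp : p ∈ fccHost) :
    IsFccTypeAt fccHost p :=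
  ⟨_, 1, barlowShellAt_fccHost hp⟩

/-- **Every site of the hcp stacking is an HCP-type site** (letters `(a, a)`, `a = ±1` the
letter of its layer, identity frame). [cite: HalesDSP2012, §1.3 (p. 12)] -/
theorem isHcpTypeAt_hcpStacking {p : EuclideanSpace ℝ (Fin 3)}
    (hp : p ∈ hcpStacking 1 (Real.sqrt (2 / 3))) :
    IsHcpTypeAt (hcpStacking 1 (Real.sqrt (2 / 3))) p := by
  obtain ⟨k, i, j, rfl⟩ := hp
  have h := barlowShellAt_barlowStacking isHaggSeq_alternating k i j
  rw [alternatingHagg_sub_one] at h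
  push_cast at h
  rw [neg_neg] at h
  exact ⟨_, _, h⟩

/-! ## §7 Gap frames, gap classes and their well-definedness

A ball `p` with a Barlow shell of frame `L` and letters `(σ, τ)` sees two interlayer GAPS: the gap
above, across which the layer is shifted by the letter `σ`, and the gap below, across which (read
upwards) the shift has letter `−τ`. A bilayer of letter `s` is, up to translation, a piece of the
cubic packing `L(M_s Λ₀)` (`Λ₀ = fccHost` has all letters `+1` along `e₃`, its twin `R_π Λ₀` all
letters `−1`). The **gap frames** `L ∘ M_σ` (up) and `L ∘ M_{−τ}` (down) record these two cubic
packings; their ORIENTATION CLASSES `F(Λ₀)` (the values of `IsOrientationObservable fccHost`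
observables) do not depend on the choice of `(L, σ, τ)` fitting the shell, up to exchanging "up"
and "down" (`gapClasses_eq_or_swap`): at an FCC-type site both classes coincide with the class of
the site's cuboctahedron; at an HCP-type site they are the two twin-related cubic classes sharing
the shell's hexagonal layer. -/

/-- The **up-gap frame** `L ∘ M_σ` of a shell datum `(L, σ, τ)`. [folklore] -/
def upFrame (L : EuclideanSpace ℝ (Fin 3) ≃ₗᵢ[ℝ] EuclideanSpace ℝ (Fin 3)) (σ : ℝ) :
    EuclideanSpace ℝ (Fin 3) ≃ₗᵢ[ℝ] EuclideanSpace ℝ (Fin 3) :=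
  (letterFrame σ).trans L

/-- The **down-gap frame** `L ∘ M_{−τ}` of a shell datum `(L, σ, τ)`. [folklore] -/
def downFrame (L : EuclideanSpace ℝ (Fin 3) ≃ₗᵢ[ℝ] EuclideanSpace ℝ (Fin 3)) (τ : ℝ) :
    EuclideanSpace ℝ (Fin 3) ≃ₗᵢ[ℝ] EuclideanSpace ℝ (Fin 3) :=
  (letterFrame (-τ)).trans L

/-- At an FCC-type datum `(L, σ, −σ)` the two gap frames coincide. [cite: KreutzZiereis2026, Lemma 2.2 (well-definedness of the local orientation; here for the two gap classes)] -/
@[simp] theorem downFrame_neg (L : EuclideanSpace ℝ (Fin 3) ≃ₗᵢ[ℝ] EuclideanSpace ℝ (Fin 3))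
    (σ : ℝ) : downFrame L (-σ) = upFrame L σ := by
  simp [downFrame, upFrame]

/-- The down-gap frame of letter `τ` is the up-gap frame of letter `−τ`. [folklore] -/
private theorem downFrame_eq_upFrame_neg (L : EuclideanSpace ℝ (Fin 3) ≃ₗᵢ[ℝ] EuclideanSpace ℝ (Fin 3))
    (τ : ℝ) : downFrame L τ = upFrame L (-τ) := rfl

/-- The up-gap frame carries the reference cuboctahedron to `L(barlowShell σ (−σ))`. [folklore] -/
private theorem image_upFrame_barlowShell (L : EuclideanSpace ℝ (Fin 3) ≃ₗᵢ[ℝ] EuclideanSpace ℝ (Fin 3))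
    {σ : ℝ} (hσ : σ = 1 ∨ σ = -1) :
    upFrame L σ '' barlowShell 1 (-1) = L '' barlowShell σ (-σ) := by
  rw [upFrame, LinearIsometryEquiv.coe_trans, Set.image_comp, image_letterFrame_barlowShell hσ]

/-- The down-gap frame carries the reference cuboctahedron to `L(barlowShell (−τ) τ)`. [folklore] -/
private theorem image_downFrame_barlowShell (L : EuclideanSpace ℝ (Fin 3) ≃ₗᵢ[ℝ] EuclideanSpace ℝ (Fin 3))
    {τ : ℝ} (hτ : τ = 1 ∨ τ = -1) :
    downFrame L τ '' barlowShell 1 (-1) = L '' barlowShell (-τ) τ := by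
  have hτ' : -τ = 1 ∨ -τ = -1 := by rcases hτ with rfl | rfl <;> norm_num
  rw [downFrame, LinearIsometryEquiv.coe_trans, Set.image_comp, image_letterFrame_barlowShell hτ',
    neg_neg]

/-- **Well-definedness of the gap classes.** Two shell data `(L, σ, τ)`, `(L', σ', τ')` fitting
the same ball `p` of `X` have the same pair of gap classes `{(L∘M_σ)Λ₀, (L∘M_{−τ})Λ₀}`, in the same
or in the opposite order (the latter only at HCP-type sites, when `L'⁻¹L` reverses the axis).
Mechanism: at FCC-type sites the shell itself is the cuboctahedron of both gaps; at HCP-type sites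
an isometry between anticuboctahedra preserves the hexagon plane and transports the two
cuboctahedra through the hexagon (`image_layerShell_fcc_of_image_layerShell_hcp`); mixed types are
impossible; and a cubic class is determined by its cuboctahedron (`Λ₀` is generated by its shell).
[cite: KreutzZiereis2026, Lemma 2.2 (well-definedness of the local orientation; here for the two gap classes)] -/
theorem gapClasses_eq_or_swap {X : Set (EuclideanSpace ℝ (Fin 3))} {p : EuclideanSpace ℝ (Fin 3)}
    {L L' : EuclideanSpace ℝ (Fin 3) ≃ₗᵢ[ℝ] EuclideanSpace ℝ (Fin 3)} {σ τ σ' τ' : ℝ}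
    (h : BarlowShellAt X p L σ τ) (h' : BarlowShellAt X p L' σ' τ') :
    (upFrame L σ '' fccHost = upFrame L' σ' '' fccHost ∧
        downFrame L τ '' fccHost = downFrame L' τ' '' fccHost) ∨
      (upFrame L σ '' fccHost = downFrame L' τ' '' fccHost ∧
        downFrame L τ '' fccHost = upFrame L' σ' '' fccHost) := by
  obtain ⟨hσ, hτ, hS⟩ := h
  obtain ⟨hσ', hτ', hS'⟩ := h'
  have hnσ : -σ = 1 ∨ -σ = -1 := by rcases hσ with rfl | rfl <;> norm_num
  have hnσ' : -σ' = 1 ∨ -σ' = -1 := by rcases hσ' with rfl | rfl <;> norm_num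
  -- the relative frame `N = L'⁻¹ ∘ L` carries `layerShell σ τ` onto `layerShell σ' τ'`
  have hrel : L '' barlowShell σ τ = L' '' barlowShell σ' τ' := by
    rw [← image_translate_eq_iff, ← hS, ← hS']
  have hN : (L.trans L'.symm) '' layerShell σ τ = layerShell σ' τ' := by
    rw [← image_barlowShell_eq_barlowShell_iff, ← image_eq_image_iff_trans_symm]; exact hrel
  -- classes from shells
  have key : ∀ {a b a' b' : ℝ}, (a = 1 ∨ a = -1) → (a' = 1 ∨ a' = -1) → b = -a → b' = -a' →
      L '' barlowShell a b = L' '' barlowShell a' b' →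
      upFrame L a '' fccHost = upFrame L' a' '' fccHost := by
    rintro a b a' b' ha ha' rfl rfl hab
    apply image_fccHost_eq_of_image_barlowShell_eq
    rw [image_upFrame_barlowShell L ha, image_upFrame_barlowShell L' ha', hab]
  rcases BarlowShellAt.letters_eq_or ⟨hσ, hτ, hS⟩ with hτe | hτe <;> subst τ <;>
    rcases BarlowShellAt.letters_eq_or ⟨hσ', hτ', hS'⟩ with hτe' | hτe' <;> subst τ'
  · -- HCP–HCP
    rcases image_layerShell_fcc_of_image_layerShell_hcp hσ' hσ hN with ⟨e1, e2⟩ | ⟨e1, e2⟩ <;>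
      rw [← image_barlowShell_eq_barlowShell_iff, ← image_eq_image_iff_trans_symm] at e1 e2
    · left
      refine ⟨key hσ hσ' rfl rfl e1, ?_⟩
      rw [downFrame_eq_upFrame_neg, downFrame_eq_upFrame_neg]
      exact key hnσ hnσ' (neg_neg σ).symm (neg_neg σ').symm e2
    · right
      constructor
      · rw [downFrame_eq_upFrame_neg]
        exact key hσ hnσ' rfl (neg_neg σ').symm e1
      · rw [downFrame_eq_upFrame_neg]
        exact key hnσ hσ' (neg_neg σ).symm rfl e2
  · -- HCP–FCC: impossible
    exact absurd hN (image_layerShell_hcp_ne_fcc _ hσ)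
  · -- FCC–HCP: impossible
    exact absurd hN (image_layerShell_fcc_ne_hcp _ hσ')
  · -- FCC–FCC
    left
    refine ⟨key hσ hσ' rfl rfl hrel, ?_⟩
    rw [downFrame_neg, downFrame_neg]
    exact key hσ hσ' rfl rfl hrel

open Classical in
/-- The **Barlow weight** of the point `p` of `X` for an observable `g` of frames: the average of
`g` over the two gap frames of a shell datum fitting `p` — `½ (g(L∘M_σ) + g(L∘M_{−τ}))` — if `p`
is Barlow-crystallized, and `0` ("vacuum / defect") otherwise. The datum is chosen by
`Classical.choose`; for an fcc ORIENTATION OBSERVABLE `g` (`IsOrientationObservable fccHost g`: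
a continuous class function for `O(3)/O_h`) the value does not depend on the choice
(`barlowWeight_eq`). At an FCC-type site it is `g` of the site's cubic frame; at an HCP-type
site it is the mean of `g` over the two twin-related cubic frames of the adjacent gaps. The
empirical measure of these weights is affine in the local density of `+` letters (the Hägg SIGN
DENSITY), which is what the broken-bond surface energy of a Barlow stacking depends on.
[cite: KreutzZiereis2026, (2.10) (piecewise-constant orientation field; here resolved by gaps)] -/
def barlowWeight (g : (EuclideanSpace ℝ (Fin 3) →L[ℝ] EuclideanSpace ℝ (Fin 3)) → ℝ)
    (X : Set (EuclideanSpace ℝ (Fin 3))) (p : EuclideanSpace ℝ (Fin 3)) : ℝ :=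
  if h : IsBarlowAt X p then
    (g (frameCLM (upFrame h.choose h.choose_spec.choose)) +
      g (frameCLM (downFrame h.choose h.choose_spec.choose_spec.choose))) / 2
  else 0

/-- Non-Barlow points carry weight `0`. [cite: KreutzZiereis2026, (2.10)] -/
theorem barlowWeight_of_not_isBarlowAt
    {g : (EuclideanSpace ℝ (Fin 3) →L[ℝ] EuclideanSpace ℝ (Fin 3)) → ℝ}
    {X : Set (EuclideanSpace ℝ (Fin 3))} {p : EuclideanSpace ℝ (Fin 3)} (h : ¬ IsBarlowAt X p) :
    barlowWeight g X p = 0 := by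
  simp [barlowWeight, h]

/-- **The Barlow weight is well defined**: for an fcc orientation observable `g` it may be
computed from ANY shell datum `(L, σ, τ)` fitting `p`. [cite: KreutzZiereis2026, Lemma 2.2 (well-definedness of the local orientation; here for the two gap classes)] -/
theorem barlowWeight_eq {g : (EuclideanSpace ℝ (Fin 3) →L[ℝ] EuclideanSpace ℝ (Fin 3)) → ℝ}
    (hg : IsOrientationObservable fccHost g) {X : Set (EuclideanSpace ℝ (Fin 3))}
    {p : EuclideanSpace ℝ (Fin 3)} {L : EuclideanSpace ℝ (Fin 3) ≃ₗᵢ[ℝ] EuclideanSpace ℝ (Fin 3)}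
    {σ τ : ℝ} (h : BarlowShellAt X p L σ τ) :
    barlowWeight g X p = (g (frameCLM (upFrame L σ)) + g (frameCLM (downFrame L τ))) / 2 := by
  have hB : IsBarlowAt X p := ⟨L, σ, τ, h⟩
  rw [barlowWeight, dif_pos hB]
  have hc : BarlowShellAt X p hB.choose hB.choose_spec.choose hB.choose_spec.choose_spec.choose :=
    hB.choose_spec.choose_spec.choose_spec
  rcases gapClasses_eq_or_swap hc h with ⟨h1, h2⟩ | ⟨h1, h2⟩
  · rw [hg.2 _ _ h1, hg.2 _ _ h2]
  · rw [hg.2 _ _ h1, hg.2 _ _ h2, add_comm]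

/-- At an FCC-type site the weight is `g` of the cubic frame `L ∘ M_σ` of the site.
[cite: KreutzZiereis2026, (2.10)] -/
theorem barlowWeight_eq_of_fccType
    {g : (EuclideanSpace ℝ (Fin 3) →L[ℝ] EuclideanSpace ℝ (Fin 3)) → ℝ}
    (hg : IsOrientationObservable fccHost g) {X : Set (EuclideanSpace ℝ (Fin 3))}
    {p : EuclideanSpace ℝ (Fin 3)} {L : EuclideanSpace ℝ (Fin 3) ≃ₗᵢ[ℝ] EuclideanSpace ℝ (Fin 3)}
    {σ : ℝ} (h : BarlowShellAt X p L σ (-σ)) :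
    barlowWeight g X p = g (frameCLM (upFrame L σ)) := by
  rw [barlowWeight_eq hg h, downFrame_neg]; ring

/-! ## §8 FCC-crystallized points (`FccTexturedSet.lean`) are FCC-type sites with the same class -/

/-- The fcc host is closed under subtraction (it is a lattice). [cite: ConwaySloane1999, Ch. 4 §6.3 (fcc = D₃, generated by its minimal vectors)] -/
theorem sub_mem_fccHost {v w : EuclideanSpace ℝ (Fin 3)} (hv : v ∈ fccHost) (hw : w ∈ fccHost) :
    v - w ∈ fccHost := by
  rw [fccHost_eq_closure_barlowShell] at *
  exact AddSubgroup.sub_mem _ hv hw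

/-- The fcc host is closed under addition (it is a lattice). [cite: ConwaySloane1999, Ch. 4 §6.3 (fcc = D₃, generated by its minimal vectors)] -/
theorem add_mem_fccHost {v w : EuclideanSpace ℝ (Fin 3)} (hv : v ∈ fccHost) (hw : w ∈ fccHost) :
    v + w ∈ fccHost := by
  rw [fccHost_eq_closure_barlowShell] at *
  exact AddSubgroup.add_mem _ hv hw

/-- **An fcc-crystallized point in the sense of `FccTexturedSet.lean` (`X` agrees on the closed
unit ball around `p` with a copy of `Λ₀` carried by the frame `R`) is an FCC-type site with frame
`R` and letters `(1, −1)`.** [cite: KreutzZiereis2026, (E3) and Definition 2.1] -/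
theorem BarlowShellAt.of_locallyCrystallineAt {X : Set (EuclideanSpace ℝ (Fin 3))}
    {p : EuclideanSpace ℝ (Fin 3)} {R : EuclideanSpace ℝ (Fin 3) ≃ₗᵢ[ℝ] EuclideanSpace ℝ (Fin 3)}
    (h : LocallyCrystallineAt fccHost 1 X p R) : BarlowShellAt X p R 1 (-1) := by
  obtain ⟨q, hq, hX⟩ := h
  refine ⟨Or.inl rfl, Or.inr rfl, ?_⟩
  rw [barlowShell_one_neg_one_eq]
  ext x
  constructor
  · rintro ⟨hx, hd⟩
    have hx' : x ∈ X ∩ Metric.closedBall p 1 := ⟨hx, Metric.mem_closedBall.2 hd.le⟩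
    rw [hX] at hx'
    obtain ⟨⟨v, hv, rfl⟩, -⟩ := hx'
    refine ⟨v - q, ⟨sub_mem_fccHost hv hq, ?_⟩, rfl⟩
    rwa [dist_eq_norm, add_sub_cancel_left, LinearIsometryEquiv.norm_map] at hd
  · rintro ⟨w, ⟨hw, hw1⟩, rfl⟩
    have hd : dist (p + R w) p = 1 := by
      rw [dist_eq_norm, add_sub_cancel_left, LinearIsometryEquiv.norm_map, hw1]
    have hx : p + R w ∈ X ∩ Metric.closedBall p 1 := by
      rw [hX]
      exact ⟨⟨w + q, add_mem_fccHost hw hq, by simp only [add_sub_cancel_right]⟩,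
        Metric.mem_closedBall.2 hd.le⟩
    exact ⟨hx.1, hd⟩

/-- Hence an fcc-crystallized point is an FCC-type site. [cite: KreutzZiereis2026, (2.9)] -/
theorem IsCrystallizedAt.isFccTypeAt {X : Set (EuclideanSpace ℝ (Fin 3))}
    {p : EuclideanSpace ℝ (Fin 3)} (h : IsCrystallizedAt fccHost 1 X p) : IsFccTypeAt X p := by
  obtain ⟨R, hR⟩ := h
  exact ⟨R, 1, BarlowShellAt.of_locallyCrystallineAt hR⟩

/-- **All frames fitting an fcc-crystallized point lie in one orientation class** — the
hypothesis `huniq` of `orientationWeight_eq` (`FccTexturedSet.lean`) HOLDS for `Λ₀` at radius `1`: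
the twelve nearest neighbours determine the rotated lattice. [cite: KreutzZiereis2026, Lemma 2.2] -/
theorem image_fccHost_eq_of_locallyCrystallineAt {X : Set (EuclideanSpace ℝ (Fin 3))}
    {p : EuclideanSpace ℝ (Fin 3)} (R R' : EuclideanSpace ℝ (Fin 3) ≃ₗᵢ[ℝ] EuclideanSpace ℝ (Fin 3))
    (hR : LocallyCrystallineAt fccHost 1 X p R) (hR' : LocallyCrystallineAt fccHost 1 X p R') :
    R '' fccHost = R' '' fccHost := by
  have h := gapClasses_eq_or_swap (BarlowShellAt.of_locallyCrystallineAt hR)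
    (BarlowShellAt.of_locallyCrystallineAt hR')
  simp only [downFrame_neg] at h
  rcases h with ⟨h1, -⟩ | ⟨h1, -⟩ <;> simpa [upFrame] using h1

/-- **The two weights agree on fcc-crystallized points**: for an fcc orientation observable `g`,
the orientation weight of `FccTexturedSet.lean` and the Barlow weight coincide at every
fcc-crystallized point (both equal `g` of any fitting frame). [cite: KreutzZiereis2026, (2.10)] -/
theorem orientationWeight_eq_barlowWeight
    {g : (EuclideanSpace ℝ (Fin 3) →L[ℝ] EuclideanSpace ℝ (Fin 3)) → ℝ}
    (hg : IsOrientationObservable fccHost g) {X : Set (EuclideanSpace ℝ (Fin 3))}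
    {p : EuclideanSpace ℝ (Fin 3)} (h : IsCrystallizedAt fccHost 1 X p) :
    orientationWeight fccHost 1 g X p = barlowWeight g X p := by
  obtain ⟨R, hR⟩ := h
  rw [orientationWeight_eq hg (image_fccHost_eq_of_locallyCrystallineAt) hR,
    barlowWeight_eq_of_fccType hg (BarlowShellAt.of_locallyCrystallineAt hR)]
  simp [upFrame]

/-! ## §9 Barlow-textured sets and the phase-aware blow-down convergence -/

/-- The **gap-resolved empirical average** `ε³ Σ_{p ∈ X} f(εp) · w_g(X, p)` of the test function
`f` against the Barlow weights of the observable `g`: the empirical measure, on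
`ℝ³ × O(3)/O_h`, of (rescaled position, cubic class of an adjacent gap), each ball contributing
half of its mass to each of its two gaps, tested against `f ⊗ g`. Non-Barlow balls contribute
nothing. [cite: KreutzZiereis2026, (2.10)] -/
def barlowTexturedAverage (ε : ℝ) (X : Finset (EuclideanSpace ℝ (Fin 3)))
    (f : EuclideanSpace ℝ (Fin 3) → ℝ)
    (g : (EuclideanSpace ℝ (Fin 3) →L[ℝ] EuclideanSpace ℝ (Fin 3)) → ℝ) : ℝ :=
  ε ^ 3 * ∑ p ∈ X, f (ε • p) * barlowWeight g (↑X : Set (EuclideanSpace ℝ (Fin 3))) p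

/-- The empty configuration has vanishing gap-resolved averages. [cite: CicaleseKreutzLeonardi2023, §2 (empirical measures)] -/
@[simp] theorem barlowTexturedAverage_empty (ε : ℝ) (f : EuclideanSpace ℝ (Fin 3) → ℝ)
    (g : (EuclideanSpace ℝ (Fin 3) →L[ℝ] EuclideanSpace ℝ (Fin 3)) → ℝ) :
    barlowTexturedAverage ε ∅ f g = 0 := by
  simp [barlowTexturedAverage]

/-- A **Barlow-textured set** — the continuum state of the phase-aware blow-down: an fcc-textured
set (`FccTexturedSet`: a Caccioppoli partition of a set `E ⊆ ℝ³` of volume `1/√2` into grains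
`G_j` of finite perimeter, each with a frame `L_j ∈ O(3)` — here read as a BARLOW frame: `L_j e₃`
is the stacking axis, `L_j` of the reference triangular layer the layers of the grain) together
with, on each grain, a measurable **sign density** `λ_j : ℝ³ → [0, 1]`: the local volume fraction
of interlayer gaps with Hägg letter `+1` relative to `L_j` (`λ_j ≡ 1`: the fcc crystal `L_j Λ₀`;
`λ_j ≡ 0`: its twin `L_j R_π Λ₀`; `λ_j ≡ ½`: e.g. hcp or double-hcp; a general Barlow stacking with
letter statistics varying along the axis: any measurable profile). The data `(L_j, λ_j)` and
`(L_j ∘ R_π, 1 − λ_j)` describe the same state, as do `(L_j ∘ S, λ_j)` for `S` in the stabiliser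
`D_3d` of the axis in `O_h`; for `λ_j ∈ {0, 1}` a.e. the axis is immaterial (four equivalent
choices). [cite: KreutzZiereis2026, (2.11)–(2.13) (the space `PC(ℝ^d; 𝒵)`, here with the phase
variable `λ` adjoined to the orientation)] -/
structure BarlowTexturedSet extends FccTexturedSet where
  /-- the sign density `λ_j` of grain `j` (density of `+1` Hägg letters relative to `frame j`) -/
  signDensity : ℕ → EuclideanSpace ℝ (Fin 3) → ℝ
  /-- each `λ_j` is (Borel) measurable -/
  measurable_signDensity : ∀ j, Measurable (signDensity j)
  /-- `0 ≤ λ_j ≤ 1` -/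
  signDensity_mem_Icc : ∀ j y, signDensity j y ∈ Set.Icc (0 : ℝ) 1

namespace BarlowTexturedSet

/-- The **twin frame** `L_j ∘ R_π` of grain `j`: the cubic frame of its gaps of letter `−1`
(`= upFrame (T.frame j) (−1)`). [folklore] -/
def twinFrame (T : BarlowTexturedSet) (j : ℕ) :
    EuclideanSpace ℝ (Fin 3) ≃ₗᵢ[ℝ] EuclideanSpace ℝ (Fin 3) :=
  rotPi.trans (T.frame j)

/-- The twin frame is the up-gap frame of letter `−1`. [folklore] -/
private theorem twinFrame_eq_upFrame (T : BarlowTexturedSet) (j : ℕ) :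
    T.twinFrame j = upFrame (T.frame j) (-1) := by
  simp [twinFrame, upFrame]

/-- The **limit of the gap-resolved empirical measures** on the Barlow-textured set `T`, tested
against `f ⊗ g`: `√2 Σ_j ∫_{G_j} f(y) (λ_j(y) g(L_j) + (1 − λ_j(y)) g(L_j ∘ R_π)) dy` — on grain
`j` the gap classes are distributed as `λ_j δ_{[L_j]} + (1 − λ_j) δ_{[L_j R_π]}`, with the fcc
number density `√2`. [cite: KreutzZiereis2026, Definition 2.3 (limit field), with the phase
variable adjoined] -/
def gapLimit (T : BarlowTexturedSet) (f : EuclideanSpace ℝ (Fin 3) → ℝ)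
    (g : (EuclideanSpace ℝ (Fin 3) →L[ℝ] EuclideanSpace ℝ (Fin 3)) → ℝ) : ℝ :=
  Real.sqrt 2 * ∑' j, ∫ y in T.grain j,
    f y * (T.signDensity j y * g (frameCLM (T.frame j)) +
      (1 - T.signDensity j y) * g (frameCLM (T.twinFrame j)))

/-- **Phase-aware (Barlow) blow-down convergence** of a sequence of finite configurations
`X k ⊆ ℝ³` to the Barlow-textured set `T`, at the scales `ε_k = (#X_k)^{-1/3}`:
(i) POSITIONS — the rescaled empirical measures `ε_k³ Σ_{p ∈ X_k} δ_{ε_k p}` converge vaguely to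
`√2 χ_E` (as in `TexturedSet.IsBlowDownLimit`; mass `1 = √2 |E|`);
(ii) GAPS — for every `f ∈ C_c(ℝ³)` and every fcc orientation observable `g` (continuous class
function of `O(3)/O_h`), the gap-resolved empirical averages converge to `T.gapLimit f g`: on each
grain `G_j` the Barlow-crystallized balls have full density `√2` and their gap classes are
asymptotically distributed as `λ_j δ_{[L_j]} + (1 − λ_j) δ_{[L_j R_π]}` (a Young-measure statement:
frames need not be exactly `L_j` at finite `k`), and non-Barlow balls carry no mass in the limit
(`IsBlowDownLimit.barlow_mass`). [cite: KreutzZiereis2026, Definition 2.3 (shape of the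
convergence; phase variable adjoined, see the module docstring)] -/
structure IsBlowDownLimit (T : BarlowTexturedSet) (X : ℕ → Finset (EuclideanSpace ℝ (Fin 3))) :
    Prop where
  /-- vague convergence of the rescaled empirical measures to `√2 χ_E` -/
  positions : ∀ f : EuclideanSpace ℝ (Fin 3) → ℝ, Continuous f → HasCompactSupport f →
    Tendsto (fun k => empiricalAverage (blowDownScale (X k)) (X k) f) atTop
      (𝓝 (Real.sqrt 2 * ∫ y in T.carrier, f y))
  /-- convergence of the gap-resolved empirical measures to `√2 Σ_j (λ_j δ_{L_j} + (1−λ_j) δ_{L_j R_π}) χ_{G_j}` -/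
  gaps : ∀ f : EuclideanSpace ℝ (Fin 3) → ℝ, Continuous f → HasCompactSupport f →
    ∀ g : (EuclideanSpace ℝ (Fin 3) →L[ℝ] EuclideanSpace ℝ (Fin 3)) → ℝ,
      IsOrientationObservable fccHost g →
      Tendsto (fun k => barlowTexturedAverage (blowDownScale (X k)) (X k) f g) atTop
        (𝓝 (T.gapLimit f g))

/-- The same for LABELLED clusters `x N : Fin N → ℝ³`, along the subsequence `φ` and after the
translations `a` (as `FccTexturedSet.IsBlowDownLimitOfClusters`).
[cite: AuYeungFrieseckeSchmidt2012, Theorem 1.1 (i) (translations and subsequence)] -/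
def IsBlowDownLimitOfClusters (T : BarlowTexturedSet)
    (x : (N : ℕ) → (Fin N → EuclideanSpace ℝ (Fin 3))) (φ : ℕ → ℕ)
    (a : ℕ → EuclideanSpace ℝ (Fin 3)) : Prop :=
  T.IsBlowDownLimit fun k => Finset.univ.image fun i => x (φ k) i - a k

/-! ### Constructors and the mass statement -/

/-- An fcc-textured set read as a Barlow-textured set: every grain purely cubic, `λ_j ≡ 1`.
[cite: KreutzZiereis2026, (2.11)–(2.13)] -/
def ofFcc (T : FccTexturedSet) : BarlowTexturedSet where
  toFccTexturedSet := T
  signDensity _ _ := 1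
  measurable_signDensity _ := measurable_const
  signDensity_mem_Icc _ _ := ⟨zero_le_one, le_rfl⟩

/-- For `λ ≡ 1` the gap limit is the orientation limit of `FccTexturedSet.IsBlowDownLimit`:
`√2 Σ_j g(L_j) ∫_{G_j} f`. [cite: KreutzZiereis2026, Definition 2.3] -/
theorem gapLimit_ofFcc (T : FccTexturedSet) (f : EuclideanSpace ℝ (Fin 3) → ℝ)
    (g : (EuclideanSpace ℝ (Fin 3) →L[ℝ] EuclideanSpace ℝ (Fin 3)) → ℝ) :
    (ofFcc T).gapLimit f g = Real.sqrt 2 * ∑' j, g (frameCLM (T.frame j)) * ∫ y in T.grain j, f y := by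
  unfold gapLimit
  congr 1
  refine tsum_congr fun j => ?_
  have : (fun y => f y * ((ofFcc T).signDensity j y * g (frameCLM ((ofFcc T).frame j)) +
      (1 - (ofFcc T).signDensity j y) * g (frameCLM ((ofFcc T).twinFrame j)))) =
      fun y => f y * g (frameCLM (T.frame j)) := by
    funext y; simp [ofFcc]
  rw [this, integral_mul_const, mul_comm]
  rfl

/-- A **single Barlow grain**: one grain `G` (finite perimeter, volume `1/√2`) with Barlow frame
`L` and sign density `lam`. [cite: KreutzZiereis2026, (2.12) (one summand)] -/
def singleGrain (G : Set (EuclideanSpace ℝ (Fin 3))) (hG : HasFinitePerimeter G)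
    (hvol : volume G = ENNReal.ofReal (1 / Real.sqrt 2))
    (L : EuclideanSpace ℝ (Fin 3) ≃ₗᵢ[ℝ] EuclideanSpace ℝ (Fin 3))
    (lam : EuclideanSpace ℝ (Fin 3) → ℝ) (hlam : Measurable lam)
    (hlam01 : ∀ y, lam y ∈ Set.Icc (0 : ℝ) 1) : BarlowTexturedSet where
  toFccTexturedSet := FccTexturedSet.singleGrain G hG hvol L
  signDensity _ := lam
  measurable_signDensity _ := hlam
  signDensity_mem_Icc _ := hlam01

/-- A **single fcc crystal** (`λ ≡ 1`), e.g. the blow-down of the truncated-octahedral Wulff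
clusters of Cicalese–Kreutz–Leonardi. [cite: CicaleseKreutzLeonardi2023, Theorem 2.3] -/
def fccCrystal (G : Set (EuclideanSpace ℝ (Fin 3))) (hG : HasFinitePerimeter G)
    (hvol : volume G = ENNReal.ofReal (1 / Real.sqrt 2))
    (L : EuclideanSpace ℝ (Fin 3) ≃ₗᵢ[ℝ] EuclideanSpace ℝ (Fin 3)) : BarlowTexturedSet :=
  singleGrain G hG hvol L (fun _ => 1) measurable_const fun _ => ⟨zero_le_one, le_rfl⟩

/-- A **single crystal of sign density `½`** (hcp `…ABAB…`, but also double-hcp `…ABAC…` and every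
stacking with asymptotically as many `+` as `−` letters: the sign density does not record letter
correlations). [cite: CicaleseKreutzLeonardi2023, Proposition 2.5 (HCP clusters)] -/
def halfSignCrystal (G : Set (EuclideanSpace ℝ (Fin 3))) (hG : HasFinitePerimeter G)
    (hvol : volume G = ENNReal.ofReal (1 / Real.sqrt 2))
    (L : EuclideanSpace ℝ (Fin 3) ≃ₗᵢ[ℝ] EuclideanSpace ℝ (Fin 3)) : BarlowTexturedSet :=
  singleGrain G hG hvol L (fun _ => 1 / 2) measurable_const fun _ => by norm_num

/-- The fcc crystal is `ofFcc` of the fcc single grain. [folklore] -/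
private theorem fccCrystal_eq_ofFcc (G : Set (EuclideanSpace ℝ (Fin 3))) (hG : HasFinitePerimeter G)
    (hvol : volume G = ENNReal.ofReal (1 / Real.sqrt 2))
    (L : EuclideanSpace ℝ (Fin 3) ≃ₗᵢ[ℝ] EuclideanSpace ℝ (Fin 3)) :
    fccCrystal G hG hvol L = ofFcc (FccTexturedSet.singleGrain G hG hvol L) := rfl

/-- Constant functions of the frame are orientation observables. [cite: KreutzZiereis2026, (2.5) (functions on A = SO(d)/G; constants)] -/
theorem isOrientationObservable_const (c : ℝ) :
    IsOrientationObservable fccHost (fun _ : EuclideanSpace ℝ (Fin 3) →L[ℝ] EuclideanSpace ℝ (Fin 3) => c) :=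
  ⟨continuous_const, fun _ _ _ => rfl⟩

/-- With the constant observable `1` the gap limit is `√2 ∫_E f` (the grains are disjoint and
`λ_j + (1 − λ_j) = 1`), for `f` integrable. [cite: KreutzZiereis2026, Definition 2.3 (total mass of the limit field)] -/
theorem gapLimit_one (T : BarlowTexturedSet) {f : EuclideanSpace ℝ (Fin 3) → ℝ}
    (hf : Integrable f) :
    T.gapLimit f (fun _ => 1) = Real.sqrt 2 * ∫ y in T.carrier, f y := by
  unfold gapLimit
  congr 1
  have : ∀ j, (fun y => f y * (T.signDensity j y * 1 + (1 - T.signDensity j y) * 1)) = f := by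
    intro j; funext y; ring
  simp_rw [this]
  exact (integral_iUnion T.partition.measurableSet T.partition.disjoint hf.integrableOn).symm

/-- **Barlow-crystallized balls carry all the mass in the limit**: under `IsBlowDownLimit`, the
rescaled empirical measures of the Barlow-crystallized balls alone (the gap-resolved averages with
`g ≡ 1`) converge to `√2 χ_E`, like those of all balls (field `positions`); the non-Barlow balls
(defects, surface) are a vanishing volume fraction. [cite: KreutzZiereis2026, Theorem 2.4 (shape:
`u ≠ 0` a.e. on the limit set)] -/
theorem IsBlowDownLimit.barlow_mass {T : BarlowTexturedSet}
    {X : ℕ → Finset (EuclideanSpace ℝ (Fin 3))} (h : T.IsBlowDownLimit X)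
    (f : EuclideanSpace ℝ (Fin 3) → ℝ) (hf : Continuous f) (hfs : HasCompactSupport f) :
    Tendsto (fun k => barlowTexturedAverage (blowDownScale (X k)) (X k) f fun _ => 1) atTop
      (𝓝 (Real.sqrt 2 * ∫ y in T.carrier, f y)) := by
  rw [← gapLimit_one T (hf.integrable_of_hasCompactSupport hfs)]
  exact h.gaps f hf hfs _ (isOrientationObservable_const 1)

/-! ### Sanity theorem: an fcc blow-down limit is a Barlow blow-down limit with `λ ≡ 1` -/

/-- An orientation observable is bounded on frames (frames lie in the compact unit ball of
`ℝ³ →L ℝ³`, on which the continuous `g` is bounded). [folklore] -/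
private theorem exists_bound_of_isOrientationObservable
    {g : (EuclideanSpace ℝ (Fin 3) →L[ℝ] EuclideanSpace ℝ (Fin 3)) → ℝ}
    (hg : IsOrientationObservable fccHost g) :
    ∃ C : ℝ, 0 ≤ C ∧ ∀ F : EuclideanSpace ℝ (Fin 3) ≃ₗᵢ[ℝ] EuclideanSpace ℝ (Fin 3),
      |g (frameCLM F)| ≤ C := by
  obtain ⟨C, hC⟩ := (isCompact_closedBall
    (0 : EuclideanSpace ℝ (Fin 3) →L[ℝ] EuclideanSpace ℝ (Fin 3)) 1).exists_bound_of_continuousOn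
    hg.1.continuousOn
  have hmem : ∀ F : EuclideanSpace ℝ (Fin 3) ≃ₗᵢ[ℝ] EuclideanSpace ℝ (Fin 3),
      frameCLM F ∈ Metric.closedBall
        (0 : EuclideanSpace ℝ (Fin 3) →L[ℝ] EuclideanSpace ℝ (Fin 3)) 1 := by
    intro F
    rw [Metric.mem_closedBall, dist_zero_right]
    exact F.toLinearIsometry.norm_toContinuousLinearMap_le
  refine ⟨C, ?_, fun F => by simpa [Real.norm_eq_abs] using hC _ (hmem F)⟩
  have := hC _ (hmem (LinearIsometryEquiv.refl ℝ _))
  exact le_trans (norm_nonneg _) this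

/-- The Barlow weight of a bounded observable is bounded by the same constant. [folklore] -/
private theorem abs_barlowWeight_le {g : (EuclideanSpace ℝ (Fin 3) →L[ℝ] EuclideanSpace ℝ (Fin 3)) → ℝ}
    {C : ℝ} (hC0 : 0 ≤ C)
    (hC : ∀ F : EuclideanSpace ℝ (Fin 3) ≃ₗᵢ[ℝ] EuclideanSpace ℝ (Fin 3), |g (frameCLM F)| ≤ C)
    (X : Set (EuclideanSpace ℝ (Fin 3))) (p : EuclideanSpace ℝ (Fin 3)) :
    |barlowWeight g X p| ≤ C := by
  unfold barlowWeight
  split_ifs with h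
  · have h1 := hC (upFrame h.choose h.choose_spec.choose)
    have h2 := hC (downFrame h.choose h.choose_spec.choose_spec.choose)
    rw [abs_le] at h1 h2 ⊢
    constructor <;> linarith [h1.1, h1.2, h2.1, h2.2]
  · simpa using hC0

open Classical in
/-- The orientation weight of the constant observable `1` is the indicator of the crystallized
points. [cite: KreutzZiereis2026, (2.10)] -/
theorem orientationWeight_const_one (X : Set (EuclideanSpace ℝ (Fin 3))) (p : EuclideanSpace ℝ (Fin 3)) :
    orientationWeight fccHost 1 (fun _ => (1 : ℝ)) X p = if IsCrystallizedAt fccHost 1 X p then 1 else 0 := by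
  unfold orientationWeight
  split_ifs <;> rfl

/-- **Pointwise comparison of the two weights**: at every point, the orientation-resolved and the
gap-resolved contributions of an orientation observable `g` (bounded by `C` on frames) differ by at
most `C` times the mass of the point if it is NOT fcc-crystallized, and agree if it is.
[cite: KreutzZiereis2026, (2.10)] -/
theorem abs_sub_weights_le {g : (EuclideanSpace ℝ (Fin 3) →L[ℝ] EuclideanSpace ℝ (Fin 3)) → ℝ}
    (hg : IsOrientationObservable fccHost g) {C : ℝ} (hC0 : 0 ≤ C)
    (hC : ∀ F : EuclideanSpace ℝ (Fin 3) ≃ₗᵢ[ℝ] EuclideanSpace ℝ (Fin 3), |g (frameCLM F)| ≤ C)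
    (X : Set (EuclideanSpace ℝ (Fin 3))) (p : EuclideanSpace ℝ (Fin 3)) (a : ℝ) :
    |a * orientationWeight fccHost 1 g X p - a * barlowWeight g X p| ≤
      C * (|a| - |a| * orientationWeight fccHost 1 (fun _ => (1 : ℝ)) X p) := by
  classical
  rw [orientationWeight_const_one]
  by_cases h : IsCrystallizedAt fccHost 1 X p
  · rw [orientationWeight_eq_barlowWeight hg h, if_pos h]; simp
  · rw [orientationWeight_of_not_isCrystallizedAt h, if_neg h, mul_zero, mul_zero, sub_zero,
      zero_sub, abs_neg, abs_mul, mul_comm C]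
    exact mul_le_mul_of_nonneg_left (abs_barlowWeight_le hC0 hC X p) (abs_nonneg a)

/-- `dim ℝ³ = 3`, for the exponents of `empiricalAverage` / `texturedAverage`. [folklore] -/
private theorem finrank_euclideanSpace_three : Module.finrank ℝ (EuclideanSpace ℝ (Fin 3)) = 3 := by
  simp

/-- **The gap-resolved and the orientation-resolved averages differ by at most `C` times the
non-crystallized mass** `ε³ Σ_{p not fcc-crystallized} |f(εp)|`, for `ε ≥ 0`.
[cite: KreutzZiereis2026, (2.10)] -/
theorem abs_texturedAverage_sub_barlowTexturedAverage_le
    {g : (EuclideanSpace ℝ (Fin 3) →L[ℝ] EuclideanSpace ℝ (Fin 3)) → ℝ}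
    (hg : IsOrientationObservable fccHost g) {C : ℝ} (hC0 : 0 ≤ C)
    (hC : ∀ F : EuclideanSpace ℝ (Fin 3) ≃ₗᵢ[ℝ] EuclideanSpace ℝ (Fin 3), |g (frameCLM F)| ≤ C)
    {ε : ℝ} (hε : 0 ≤ ε) (X : Finset (EuclideanSpace ℝ (Fin 3))) (f : EuclideanSpace ℝ (Fin 3) → ℝ) :
    |texturedAverage fccHost 1 ε X f g - barlowTexturedAverage ε X f g| ≤
      C * (empiricalAverage ε X (fun y => |f y|) -
        texturedAverage fccHost 1 ε X (fun y => |f y|) (fun _ => (1 : ℝ))) := by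
  simp only [texturedAverage, empiricalAverage, barlowTexturedAverage, finrank_euclideanSpace_three]
  rw [← mul_sub, ← Finset.sum_sub_distrib, ← mul_sub, ← Finset.sum_sub_distrib, abs_mul,
    abs_of_nonneg (pow_nonneg hε 3), mul_left_comm]
  refine mul_le_mul_of_nonneg_left ?_ (pow_nonneg hε 3)
  rw [Finset.mul_sum]
  exact (Finset.abs_sum_le_sum_abs _ _).trans (Finset.sum_le_sum fun p _ =>
    abs_sub_weights_le hg hC0 hC _ p _)

/-- **An fcc blow-down limit is a Barlow blow-down limit with `λ ≡ 1` and the same frames**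
(`BarlowTexturedSet.ofFcc`). No hard-core hypothesis is needed: positions are the same statement;
for the gaps, the fcc-crystallized balls are FCC-type sites with the same class and the same
weight (`orientationWeight_eq_barlowWeight`), and the remaining balls have vanishing mass (field
`positions` versus `orientations` with `g ≡ 1`), while the weights are bounded.
[cite: KreutzZiereis2026, Definition 2.3] -/
theorem _root_.Literature.MathematicalPhysics.StatisticalMechanics.FccTexturedSet.IsBlowDownLimit.ofFcc
    {T : FccTexturedSet} {X : ℕ → Finset (EuclideanSpace ℝ (Fin 3))} (h : T.IsBlowDownLimit X) :
    (BarlowTexturedSet.ofFcc T).IsBlowDownLimit X where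
  positions := h.positions
  gaps := by
    intro f hf hfs g hg
    obtain ⟨C, hC0, hC⟩ := exists_bound_of_isOrientationObservable hg
    set ε : ℕ → ℝ := fun k => blowDownScale (X k) with hε
    have hε0 : ∀ k, 0 ≤ ε k := fun k => by
      simp only [hε, blowDownScale]; exact Real.rpow_nonneg (Nat.cast_nonneg _) _
    -- the orientation-resolved averages converge (FccTexturedSet.IsBlowDownLimit)
    have hT : Tendsto (fun k => texturedAverage fccHost 1 (ε k) (X k) f g) atTop
        (𝓝 ((BarlowTexturedSet.ofFcc T).gapLimit f g)) := by
      rw [gapLimit_ofFcc]; exact h.orientations f hf hfs g hg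
    -- the non-crystallized mass tends to `0`
    have hfa : Continuous fun y => |f y| := continuous_abs.comp hf
    have hfas : HasCompactSupport fun y => |f y| := hfs.comp_left abs_zero
    have hint : Integrable (fun y => |f y|) := hfa.integrable_of_hasCompactSupport hfas
    have hA : Tendsto (fun k => empiricalAverage (ε k) (X k) fun y => |f y|) atTop
        (𝓝 (Real.sqrt 2 * ∫ y in ⋃ j, T.grain j, |f y|)) := h.positions _ hfa hfas
    have hB := h.orientations _ hfa hfas _ (isOrientationObservable_const 1)
    simp only [one_mul] at hB
    rw [← integral_iUnion T.partition.measurableSet T.partition.disjoint hint.integrableOn] at hB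
    have hAB : Tendsto (fun k => C * (empiricalAverage (ε k) (X k) (fun y => |f y|) -
        texturedAverage fccHost 1 (ε k) (X k) (fun y => |f y|) (fun _ => (1 : ℝ)))) atTop (𝓝 0) := by
      have := (hA.sub hB).const_mul C
      simpa using this
    -- squeeze
    have hD : Tendsto (fun k => texturedAverage fccHost 1 (ε k) (X k) f g -
        barlowTexturedAverage (ε k) (X k) f g) atTop (𝓝 0) :=
      squeeze_zero_norm (fun k => by
        rw [Real.norm_eq_abs]
        exact abs_texturedAverage_sub_barlowTexturedAverage_le hg hC0 hC (hε0 k) (X k) f) hAB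
    have := hT.sub hD
    simpa using this

end BarlowTexturedSet


/-! ## §10 Bridge to Hales's patterns: FCC-type / HCP-type sites are the sites whose doubled,
recentred shell is arranged in `fccKissingPattern` / `hcpKissingPattern`

The venture files (`Summits/Ventures/Crystal3D/Bulk/LocalTwelve.lean`: `contactShell`,
`IsClosePackedShell x i := IsArrangedIn (contactShell x i) fccKissingPattern ∨ … hcpKissingPattern`)
read close-packed shells through the tree's `IsArrangedIn` (`FejesTothKissingTwelve.lean`, Hales 2012
Lemma 10: "congruent to the FCC or HCP configuration in `S²(2)`") on the doubled recentred shell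
`{2(x − p)}`. This section proves that reading and the Barlow-shell reading of §6 agree. -/

/-- The **doubled recentred shell** of `p` in `X`: `{2(x − p) : x ∈ X, dist(x, p) = 1} ⊂ S²(2)` — the
contact shell in Hales's normalisation (the venture's `contactShell`, the tree's `kissingShell` of
the doubled configuration). [cite: Hales2012, §1, Definition 1] -/
def doubledShellAt (X : Set (EuclideanSpace ℝ (Fin 3))) (p : EuclideanSpace ℝ (Fin 3)) :
    Set (EuclideanSpace ℝ (Fin 3)) :=
  (fun x => (2 : ℝ) • (x - p)) '' {x | x ∈ X ∧ dist x p = 1}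

/-- Doubling the recentred translate of a unit-spacing shell gives the Hales-spacing shell:
`2((p + L(½y)) − p) = L y`. [cite: HalesDSP2012, §1.3 (pp. 12–13: unit balls, touching centres at distance 2)] -/
theorem image_double_sub_image_translate
    (p : EuclideanSpace ℝ (Fin 3)) (L : EuclideanSpace ℝ (Fin 3) ≃ₗᵢ[ℝ] EuclideanSpace ℝ (Fin 3))
    (σ τ : ℝ) :
    (fun x => (2 : ℝ) • (x - p)) '' ((fun v => p + L v) '' barlowShell σ τ) = L '' layerShell σ τ := by
  rw [Set.image_image, barlowShell, Set.image_image]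
  refine Set.image_congr' fun y => ?_
  rw [add_sub_cancel_left, ← map_smul, smul_smul, mul_inv_cancel₀ (two_ne_zero (α := ℝ)), one_smul]

/-- **`BarlowShellAt` in Hales's normalisation**: `p` has the Barlow shell of frame `L` and letters
`(σ, τ)` iff its doubled recentred shell is `L(layerShell σ τ)`. [cite: HalesDSP2012, §1.3 (Fig. 1.11)] -/
theorem barlowShellAt_iff_doubledShellAt {X : Set (EuclideanSpace ℝ (Fin 3))}
    {p : EuclideanSpace ℝ (Fin 3)} {L : EuclideanSpace ℝ (Fin 3) ≃ₗᵢ[ℝ] EuclideanSpace ℝ (Fin 3)}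
    {σ τ : ℝ} (hσ : σ = 1 ∨ σ = -1) (hτ : τ = 1 ∨ τ = -1) :
    BarlowShellAt X p L σ τ ↔ doubledShellAt X p = L '' layerShell σ τ := by
  have hinj : Function.Injective (fun x : EuclideanSpace ℝ (Fin 3) => (2 : ℝ) • (x - p)) :=
    fun x y hxy => sub_left_injective (smul_right_injective _ (two_ne_zero (α := ℝ)) hxy)
  simp only [BarlowShellAt, hσ, hτ, true_and, doubledShellAt]
  rw [← image_double_sub_image_translate p L σ τ, (Set.image_injective.2 hinj).eq_iff]

/-- A linear isometry equivalence preserves arrangement in a pattern (the summit side has the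
same one-liner as `Summit.AtomisticToContinuum.Crystallization.Theorems.IsArrangedIn.image_equiv`;
restated in Literature so that Literature files can use it). [cite: Hales2012, Lemma 10] -/
theorem _root_.Literature.Geometry.DiscreteGeometry.IsArrangedIn.image_linearIsometryEquiv
    {T : Set (EuclideanSpace ℝ (Fin 3))} {P : Finset (EuclideanSpace ℝ (Fin 3))}
    (h : IsArrangedIn T P) (L : EuclideanSpace ℝ (Fin 3) ≃ₗᵢ[ℝ] EuclideanSpace ℝ (Fin 3)) :
    IsArrangedIn (L '' T) P := by
  obtain ⟨A, rfl⟩ := h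
  refine ⟨L.toLinearIsometry.comp A, ?_⟩
  rw [Set.image_image]
  refine Set.image_congr' fun q => ?_
  simp

/-- **An FCC-type site has its doubled shell arranged in the FCC pattern (cuboctahedron).**
[cite: Hales2012, Lemma 10] [cite: HalesDSP2012, §1.3 (Fig. 1.11)] -/
theorem IsFccTypeAt.isArrangedIn {X : Set (EuclideanSpace ℝ (Fin 3))} {p : EuclideanSpace ℝ (Fin 3)}
    (h : IsFccTypeAt X p) : IsArrangedIn (doubledShellAt X p) fccKissingPattern := by
  obtain ⟨L, σ, hL⟩ := h
  rw [(barlowShellAt_iff_doubledShellAt hL.1 hL.2.1).1 hL]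
  exact (isArrangedIn_layerShell_fcc' hL.1).image_linearIsometryEquiv L

/-- **An HCP-type site has its doubled shell arranged in the HCP pattern (anticuboctahedron).**
[cite: Hales2012, Lemma 10] [cite: HalesDSP2012, §1.3 (Fig. 1.11)] -/
theorem IsHcpTypeAt.isArrangedIn {X : Set (EuclideanSpace ℝ (Fin 3))} {p : EuclideanSpace ℝ (Fin 3)}
    (h : IsHcpTypeAt X p) : IsArrangedIn (doubledShellAt X p) hcpKissingPattern := by
  obtain ⟨L, σ, hL⟩ := h
  rw [(barlowShellAt_iff_doubledShellAt hL.1 hL.2.1).1 hL]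
  exact (isArrangedIn_layerShell_hcp' hL.1).image_linearIsometryEquiv L

/-- Two sets arranged in the same pattern differ by a linear isometry equivalence (the patterns
are rigid; a linear isometry of `ℝ³` is onto). [cite: Hales2012, Lemma 10] -/
theorem exists_linearIsometryEquiv_image_eq_of_isArrangedIn
    {S T : Set (EuclideanSpace ℝ (Fin 3))} {P : Finset (EuclideanSpace ℝ (Fin 3))}
    (hS : IsArrangedIn S P) (hT : IsArrangedIn T P) :
    ∃ L : EuclideanSpace ℝ (Fin 3) ≃ₗᵢ[ℝ] EuclideanSpace ℝ (Fin 3), T = L '' S := by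
  obtain ⟨A, rfl⟩ := hS
  obtain ⟨B, rfl⟩ := hT
  let EA := A.toLinearIsometryEquiv rfl
  let EB := B.toLinearIsometryEquiv rfl
  refine ⟨EA.symm.trans EB, ?_⟩
  rw [Set.image_image]
  refine Set.image_congr' fun q => ?_
  simp only [LinearIsometryEquiv.coe_trans, Function.comp_apply, map_smul]
  congr 1
  change B q = EB (EA.symm (EA q))
  rw [LinearIsometryEquiv.symm_apply_apply]
  rfl

/-- **Conversely, a site whose doubled shell is arranged in the FCC pattern is an FCC-type site.**
[cite: Hales2012, Lemma 10] [cite: HalesDSP2012, §1.3 (Fig. 1.11)] -/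
theorem isFccTypeAt_of_isArrangedIn {X : Set (EuclideanSpace ℝ (Fin 3))} {p : EuclideanSpace ℝ (Fin 3)}
    (h : IsArrangedIn (doubledShellAt X p) fccKissingPattern) : IsFccTypeAt X p := by
  obtain ⟨L, hL⟩ := exists_linearIsometryEquiv_image_eq_of_isArrangedIn
    (isArrangedIn_layerShell_fcc' (σ := 1) (Or.inl rfl)) h
  exact ⟨L, 1, (barlowShellAt_iff_doubledShellAt (Or.inl rfl) (Or.inr rfl)).2 hL⟩

/-- **Conversely, a site whose doubled shell is arranged in the HCP pattern is an HCP-type site.**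
[cite: Hales2012, Lemma 10] [cite: HalesDSP2012, §1.3 (Fig. 1.11)] -/
theorem isHcpTypeAt_of_isArrangedIn {X : Set (EuclideanSpace ℝ (Fin 3))} {p : EuclideanSpace ℝ (Fin 3)}
    (h : IsArrangedIn (doubledShellAt X p) hcpKissingPattern) : IsHcpTypeAt X p := by
  obtain ⟨L, hL⟩ := exists_linearIsometryEquiv_image_eq_of_isArrangedIn
    (isArrangedIn_layerShell_hcp' (σ := 1) (Or.inl rfl)) h
  exact ⟨L, 1, (barlowShellAt_iff_doubledShellAt (Or.inl rfl) (Or.inl rfl)).2 hL⟩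

/-- `IsFccTypeAt X p ↔` the doubled shell is arranged in `fccKissingPattern`.
[cite: Hales2012, Lemma 10] -/
theorem isFccTypeAt_iff_isArrangedIn {X : Set (EuclideanSpace ℝ (Fin 3))}
    {p : EuclideanSpace ℝ (Fin 3)} :
    IsFccTypeAt X p ↔ IsArrangedIn (doubledShellAt X p) fccKissingPattern :=
  ⟨IsFccTypeAt.isArrangedIn, isFccTypeAt_of_isArrangedIn⟩

/-- `IsHcpTypeAt X p ↔` the doubled shell is arranged in `hcpKissingPattern`.
[cite: Hales2012, Lemma 10] -/
theorem isHcpTypeAt_iff_isArrangedIn {X : Set (EuclideanSpace ℝ (Fin 3))}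
    {p : EuclideanSpace ℝ (Fin 3)} :
    IsHcpTypeAt X p ↔ IsArrangedIn (doubledShellAt X p) hcpKissingPattern :=
  ⟨IsHcpTypeAt.isArrangedIn, isHcpTypeAt_of_isArrangedIn⟩

/-- **`IsBarlowAt` = "close-packed shell" in Hales's sense**: the doubled recentred shell is
arranged in the FCC or in the HCP pattern (the venture's `IsClosePackedShell`, for point sets).
[cite: Hales2012, Theorem 1 (conclusion: "arranged in the pattern of the HCP or of the FCC")] -/
theorem isBarlowAt_iff_isArrangedIn {X : Set (EuclideanSpace ℝ (Fin 3))}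
    {p : EuclideanSpace ℝ (Fin 3)} :
    IsBarlowAt X p ↔ IsArrangedIn (doubledShellAt X p) fccKissingPattern ∨
      IsArrangedIn (doubledShellAt X p) hcpKissingPattern := by
  rw [isBarlowAt_iff, isFccTypeAt_iff_isArrangedIn, isHcpTypeAt_iff_isArrangedIn]

/-- In particular **no shell is arranged in both patterns** (cf. `not_shellCloseTo_fcc_and_hcp`
of `KissingPatternsExclusive.lean`, the `δ`-robust form). [cite: HalesDSP2012, §1.3 (Fig. 1.11)] -/
theorem not_isArrangedIn_fcc_and_hcp {X : Set (EuclideanSpace ℝ (Fin 3))}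
    {p : EuclideanSpace ℝ (Fin 3)} :
    ¬ (IsArrangedIn (doubledShellAt X p) fccKissingPattern ∧
        IsArrangedIn (doubledShellAt X p) hcpKissingPattern) := by
  rintro ⟨h1, h2⟩
  exact not_isFccTypeAt_of_isHcpTypeAt (isHcpTypeAt_of_isArrangedIn h2) (isFccTypeAt_of_isArrangedIn h1)

end Literature.MathematicalPhysics.StatisticalMechanics
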